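import Mathlib.Analysis.Fourier.Inversion
import Mathlib.Analysis.Calculus.BumpFunction.Normed
import Mathlib.Analysis.Calculus.BumpFunction.InnerProduct
import Literature.Analysis.Fourier.PaleyWienerDeformation
import Literature.Analysis.Fourier.MultiplierOpDeriv
import Literature.Analysis.Fourier.GradientBoundInterpolation
import Literature.Analysis.Fourier.GradientBoundLpMultiplier
import Literature.Barriers.AtomisticToContinuum.NoBVEstimatesMultiDLinearStepAssembly
import HarnessLib

/-!
# Finite speed of propagation for constant-coefficient systems in Rauch's class, and the
discharge of `Rauch1986_L1GradientEstimate_imp_LpMultiplier`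

`NoBVEstimatesMultiDLinearStepAssembly.lean` proves Rauch's reduction
`Rauch1986_L1GradientEstimate_imp_LpMultiplier` [Rauch1986, Proof of Theorem p. 483, (5)–(6)]
relative to three inputs (`Rauch1986_L1GradientEstimate_imp_LpMultiplier_of`): the interpolation
of the homogeneous Sobolev spaces (`Literature.Analysis.Fourier.gradientLpBound_interpolation`,
now `…_holds`), Rauch's (6) with the Riesz transforms
(`Literature.Analysis.Fourier.isLpMultiplier_of_gradientLpBound`, now `…_holds`), and finite speed
of propagation `Rauch1986_finitePropagationSpeed`, whose strictly hyperbolic branch for general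
quasilinear systems (`d ≥ 2`, `k ≥ 3`) is not in the tree. The assembly, however, applies finite
propagation speed only to the CONSTANT-COEFFICIENT system `ofConstant A₀ A 0` (to know that the
solutions `v` of hypothesis (5) stay compactly supported on `[0, T]`, so that `v(T) = M_T(D)φ`).
This file proves that case for both branches of Rauch's class (`hasPropagationSpeed_ofConstant`)
and thereby discharges the fact (`Rauch1986_L1GradientEstimate_imp_LpMultiplier_holds`).

## The proof of finite propagation speed (constant coefficients, Rauch's class at `0`)

Holmgren–John duality with explicit adjoint solutions, the support of the adjoint solutions
coming from the Paley–Wiener deformation theorem of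
`Literature/Analysis/Fourier/PaleyWienerDeformation.lean`:

1. *Adjoint generator at complex frequencies.* With `G*(ξ) = (A₀⁻¹)ᵀ_ℂ (2πi Σ ξ_l (A_l)ᵀ_ℂ)`
   (`adjGen`) and `L_τ = -τG*` (`adjPencil`), the deformed symbol is a transposed conjugate of
   Rauch's multiplier WITH the zeroth-order term `B_b = -2πb Σν_lA_l`:
   `exp(L_τξ + ibL_τν) = (A₀_ℂ · rauchSymbol A₀ A B_b τ ξ · (A₀⁻¹)_ℂ)ᵀ` (`symM_adjPencil_eq`).
   Hence Brenner's bound (0.3) in the form proved in `NoBVEstimatesMultiDSymbolBound.lean`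
   (`norm_rauchSymbol_apply_le_of_symmetrizer`: the principal part drops out of the energy
   identity, the zeroth-order term enters through `e^{|τ|N'/m}`, `N' ≲ |b|`) gives the
   exponential type `|exp(L_τξ + ibL_τν)ᵢⱼ| ≤ C e^{2πc₀|τ||b|}` (`exists_hasExpType_adjPencil`),
   with the symmetrizer family of both branches (`exists_continuous_symmetrizer_family`).
2. *Adjoint solutions.* `w(t) = e^{-(t-t₀)G*}(D)ψ` (`adjSol`) for `ψ ∈ C_c^∞(ℝᵈ; ℂᵏ)` supported
   in `B̄(x₁, r)`: by the Paley–Wiener theorem `w(t, x) = 0` for `‖x - x₁‖ > r + c₀|t - t₀|`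
   (`adjSol_eq_zero`); `w(t₀) = ψ` (Fourier inversion, `adjSol_self`); `∂ⱼw(t) = M*(D)∂ⱼψ`
   (`fderiv_adjSol_apply`, from `MultiplierOpDeriv.lean`); `∂ₜw = 𝓕⁻¹[-G*M*𝓕ψ]`
   (`hasDerivAt_adjSol`, differentiation under the inverse Fourier integral); and the adjoint
   equation `A₀ᵀ∂ₜw + Σ Aⱼᵀ∂ⱼw = 0` (`adjoint_eqn`, from `A₀ᵀ(A₀⁻¹)ᵀ = 1` on the Fourier side).
3. *Duality.* For a classical solution `u` on `[0, T]` and `0 < t₀ ≤ T`,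
   `P(t) = ∫ (A₀u(t, x))_ℂ · w(t, x) dx` is continuous on `[0, t₀]` and `P' = 0` on `(0, t₀)`
   (`integral_pairF_eq`): `P' = ∫ [(A₀∂ₜu)·w + (A₀u)·∂ₜw] = -Σⱼ ∫ ∂ⱼ[(Aⱼu)·w] = 0` by the two
   equations and integration by parts in `x` (`w(t)` is compactly supported; Mathlib's
   `integral_bilinear_hasLineDerivAt_right_eq_neg_left_of_integrable`). So
   `∫ (A₀u(t₀))_ℂ·ψ = P(t₀) = P(0) = 0` when `u(0)` vanishes on `‖x‖ > R` and
   `‖x₁‖ - R - c₀t₀ ≥ 2r` (`integral_mulVec_dotProduct_eq_zero`), and localising with bumps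
   `ψ = φ eᵢ` gives `A₀u(t₀, x₁) = 0`, i.e. `u(t₀, x₁) = 0` (`hasPropagationSpeed_ofConstant`).

This is the constant-coefficient case of "the finite speed of propagation for (1)"
[Rauch1986, Proof of Theorem p. 482]; for the linear constant-coefficient system it is the
classical Paley–Wiener/Holmgren argument (e.g. [Hörmander, ALPDO II, Thm 12.5.1], [John1982,
Ch. 5 §3]), with Brenner's symbol bound [Brenner1973, (0.3) p. 75] supplying the exponential type.

## References

* [Rauch1986] J. Rauch, Comm. Math. Phys. 106 (1986) 481–484, Proof of Theorem pp. 482–483,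
  (4)–(6).
* [Brenner1973] P. Brenner, Ark. Mat. 11 (1973) 75–101, (0.3) p. 75.
-/

noncomputable section

open MeasureTheory Set Filter Matrix FourierTransform Metric Complex
open scoped ENNReal NNReal ContDiff Topology RealInnerProductSpace Matrix.Norms.Operator

namespace Literature.Barriers.AtomisticToContinuum

open Literature.Analysis.Fourier Literature.Analysis.FluidPDE QuasilinearSystem

variable {d k : ℕ}

/-! ### The adjoint generator at complex frequencies -/

section AdjointGenerator

variable (A₀ : Matrix (Fin k) (Fin k) ℝ) (A : Fin d → Matrix (Fin k) (Fin k) ℝ)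

/-- The generator of the adjoint system in Fourier variables,
`G*(ξ) = (A₀⁻¹)ᵀ_ℂ (2πi Σ_l ξ_l (A_l)ᵀ_ℂ)`, as a real-linear map of `ξ`.
[cite: Rauch1986, Proof of Theorem p. 482] -/
def adjGen : Space d →L[ℝ] Matrix (Fin k) (Fin k) ℂ :=
  ∑ l, (EuclideanSpace.proj l : Space d →L[ℝ] ℝ).smulRight
    (((A₀⁻¹)ᵀ).map (algebraMap ℝ ℂ) * ((2 * Real.pi * I) • ((A l)ᵀ).map (algebraMap ℝ ℂ)))

/-- `G*(ξ) = (A₀⁻¹)ᵀ_ℂ Σ_l (2πξ_l i) (A_l)ᵀ_ℂ`. [folklore] -/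
theorem adjGen_apply (ξ : Space d) :
    adjGen A₀ A ξ = ((A₀⁻¹)ᵀ).map (algebraMap ℝ ℂ) *
      ∑ l, (((2 * Real.pi * ξ l : ℝ) : ℂ) * I) • ((A l)ᵀ).map (algebraMap ℝ ℂ) := by
  simp only [adjGen, FunLike.coe_sum, Finset.sum_apply, ContinuousLinearMap.smulRight_apply,
    Finset.mul_sum]
  refine Finset.sum_congr rfl fun l _ => ?_
  rw [Matrix.mul_smul]
  have hproj : (EuclideanSpace.proj l) ξ = ξ l := rfl
  -- normalise the scalar in front
  have hsc : ∀ (c : ℂ) (P : Matrix (Fin k) (Fin k) ℂ), (ξ l) • (c • P) = ((ξ l : ℂ) * c) • P :=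
    fun c P => by rw [← Complex.coe_smul, smul_smul]
  simp only [hproj, Matrix.mul_smul, hsc]
  congr 1
  push_cast
  ring

/-- A bound for the adjoint generator: `K_G = Σ_l ‖(A₀⁻¹)ᵀ_ℂ (2πi (A_l)ᵀ_ℂ)‖`. [folklore] -/
def adjGenBound : ℝ :=
  ∑ l, ‖((A₀⁻¹)ᵀ).map (algebraMap ℝ ℂ) * ((2 * Real.pi * I) • ((A l)ᵀ).map (algebraMap ℝ ℂ))‖

/-- `0 ≤ K_G`. [folklore] -/
theorem adjGenBound_nonneg : 0 ≤ adjGenBound A₀ A :=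
  Finset.sum_nonneg fun _ _ => norm_nonneg _

/-- `‖G*(ξ)‖ ≤ K_G ‖ξ‖`. [folklore] -/
theorem norm_adjGen_le (ξ : Space d) : ‖adjGen A₀ A ξ‖ ≤ adjGenBound A₀ A * ‖ξ‖ := by
  simp only [adjGen, FunLike.coe_sum, Finset.sum_apply, ContinuousLinearMap.smulRight_apply,
    adjGenBound, Finset.sum_mul]
  refine (norm_sum_le _ _).trans (Finset.sum_le_sum fun l _ => ?_)
  rw [norm_smul, mul_comm]
  refine mul_le_mul_of_nonneg_left ?_ (norm_nonneg _)
  have h := PiLp.norm_apply_le ξ l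
  exact h

/-- The zeroth-order term realising the complex frequency shift: `B_b = -2πb Σ_l ν_l A_l`.
[folklore] -/
def shiftCLM (ν : Space d) (b : ℝ) : (Fin k → ℝ) →L[ℝ] (Fin k → ℝ) :=
  LinearMap.toContinuousLinearMap (Matrix.toLin' ((-(2 * Real.pi * b)) • ∑ l, ν l • A l))

/-- The matrix of `B_b` is `-2πb Σ_l ν_l A_l`. [folklore] -/
theorem toMatrix'_shiftCLM (ν : Space d) (b : ℝ) :
    LinearMap.toMatrix' (shiftCLM A ν b : (Fin k → ℝ) →ₗ[ℝ] (Fin k → ℝ)) =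
      (-(2 * Real.pi * b)) • ∑ l, ν l • A l := by
  simp [shiftCLM]

variable {A₀}

/-- `A₀_ℂ (A₀⁻¹)_ℂ = 1`. [folklore] -/
theorem map_mul_map_inv (hdet : A₀.det ≠ 0) :
    A₀.map (algebraMap ℝ ℂ) * (A₀⁻¹).map (algebraMap ℝ ℂ) = 1 := by
  rw [← Matrix.map_mul, mul_nonsing_inv _ (isUnit_iff_ne_zero.2 hdet),
    Matrix.map_one _ (map_zero _) (map_one _)]

/-- `(A₀⁻¹)_ℂ A₀_ℂ = 1`. [folklore] -/
theorem map_inv_mul_map (hdet : A₀.det ≠ 0) :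
    (A₀⁻¹).map (algebraMap ℝ ℂ) * A₀.map (algebraMap ℝ ℂ) = 1 := by
  rw [← Matrix.map_mul, nonsing_inv_mul _ (isUnit_iff_ne_zero.2 hdet),
    Matrix.map_one _ (map_zero _) (map_one _)]

/-- `(A₀⁻¹)_ℂ = (A₀_ℂ)⁻¹`. [folklore] -/
theorem map_inv_eq_inv_map (hdet : A₀.det ≠ 0) :
    (A₀⁻¹).map (algebraMap ℝ ℂ) = (A₀.map (algebraMap ℝ ℂ))⁻¹ :=
  (Matrix.inv_eq_right_inv (map_mul_map_inv hdet)).symm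

/-- `A₀_ℂ` is invertible when `det A₀ ≠ 0`. [folklore] -/
theorem isUnit_map (hdet : A₀.det ≠ 0) : IsUnit (A₀.map (algebraMap ℝ ℂ)) :=
  (Matrix.isUnit_iff_isUnit_det _).2 (Matrix.isUnit_det_of_right_inverse (map_mul_map_inv hdet))

/-- **The adjoint generator at the complex frequency `ξ + ibν` is the transposed conjugate of
Rauch's generator with zeroth-order term `B_b`**:
`G*(ξ) + ib G*(ν) = (A₀_ℂ · rauchGenerator A₀ A B_b ξ · (A₀⁻¹)_ℂ)ᵀ`.
[cite: Rauch1986, Proof of Theorem p. 483] -/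
theorem adjGen_add_smul_eq (hdet : A₀.det ≠ 0) (ν ξ : Space d) (b : ℝ) :
    adjGen A₀ A ξ + ((b : ℂ) * I) • adjGen A₀ A ν =
      (A₀.map (algebraMap ℝ ℂ) * rauchGenerator A₀ A (shiftCLM A ν b) ξ *
        (A₀⁻¹).map (algebraMap ℝ ℂ))ᵀ := by
  -- the right side is `((A₀⁻¹)ᵀ)_ℂ Yᵀ`
  unfold rauchGenerator
  rw [toMatrix'_shiftCLM]
  simp only [← Matrix.mul_assoc]
  rw [map_mul_map_inv hdet, Matrix.one_mul, transpose_mul, ← transpose_map, adjGen_apply,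
    adjGen_apply, ← Matrix.mul_smul, ← Matrix.mul_add]
  congr 1
  -- the zeroth-order term, transposed and complexified
  have hB : (((-(2 * Real.pi * b)) • ∑ l, ν l • A l).map (algebraMap ℝ ℂ))ᵀ =
      ∑ l, ((-(2 * Real.pi * b * ν l) : ℝ) : ℂ) • ((A l)ᵀ).map (algebraMap ℝ ℂ) := by
    ext i j
    simp only [transpose_apply, Matrix.map_apply, Matrix.smul_apply, Matrix.sum_apply,
      smul_eq_mul, Complex.coe_algebraMap]
    push_cast
    rw [Finset.mul_sum]
    refine Finset.sum_congr rfl fun l _ => ?_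
    ring
  have hP : (∑ l, (2 * Real.pi * ((ξ l : ℝ) : ℂ) * I) • (A l).map (algebraMap ℝ ℂ))ᵀ =
      ∑ l, (2 * Real.pi * ((ξ l : ℝ) : ℂ) * I) • ((A l)ᵀ).map (algebraMap ℝ ℂ) := by
    rw [transpose_sum]
    refine Finset.sum_congr rfl fun l _ => ?_
    rw [transpose_smul, transpose_map]
  rw [transpose_add, hB, hP, Finset.smul_sum, ← Finset.sum_add_distrib, ← Finset.sum_add_distrib]
  refine Finset.sum_congr rfl fun l _ => ?_
  rw [smul_smul, ← add_smul, ← add_smul]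
  congr 1
  have hI : I * I = -1 := I_mul_I
  push_cast
  linear_combination (2 * (Real.pi : ℂ) * (b : ℂ) * ((ν l : ℝ) : ℂ)) * hI

end AdjointGenerator

/-! ### The adjoint pencil and its deformed symbols -/

section AdjointPencil

variable {A₀ : Matrix (Fin k) (Fin k) ℝ} (A : Fin d → Matrix (Fin k) (Fin k) ℝ)

/-- The adjoint pencil at time `τ`: `L_τ(ξ) = -τ G*(ξ)`, so that `exp(L_τ ξ) = e^{-τG*(ξ)}` is
the Fourier symbol of the adjoint evolution. [cite: Rauch1986, Proof of Theorem p. 482] -/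
def adjPencil (A₀ : Matrix (Fin k) (Fin k) ℝ) (A : Fin d → Matrix (Fin k) (Fin k) ℝ) (τ : ℝ) :
    Space d →L[ℝ] Matrix (Fin k) (Fin k) ℂ :=
  (-τ) • adjGen A₀ A

/-- `L_τ(ξ) = (-τ) • G*(ξ)` (complex scalar). [folklore] -/
theorem adjPencil_apply (A₀ : Matrix (Fin k) (Fin k) ℝ) (τ : ℝ) (ξ : Space d) :
    adjPencil A₀ A τ ξ = (-(τ : ℂ)) • adjGen A₀ A ξ := by
  rw [adjPencil, _root_.smul_apply, ← Complex.coe_smul, Complex.ofReal_neg]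

variable {A}

/-- **The deformed adjoint symbol is a transposed conjugate of Rauch's multiplier with the
zeroth-order term `B_b`**:
`exp(L_τ ξ + ib L_τ ν) = (A₀_ℂ · rauchSymbol A₀ A B_b τ ξ · (A₀⁻¹)_ℂ)ᵀ`.
[cite: Rauch1986, Proof of Theorem p. 483] -/
theorem symM_adjPencil_eq (hdet : A₀.det ≠ 0) (τ : ℝ) (ν : Space d) (b : ℝ) (ξ : Space d) :
    symM (adjPencil A₀ A τ) ν b ξ =
      (A₀.map (algebraMap ℝ ℂ) * rauchSymbol A₀ A (shiftCLM A ν b) τ ξ *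
        (A₀⁻¹).map (algebraMap ℝ ℂ))ᵀ := by
  have hU := isUnit_map hdet
  rw [symM, adjPencil_apply, adjPencil_apply, smul_comm, ← smul_add]
  -- transport the generator identity (stated with this file's instances) into the goal
  have hX := congrArg (fun X : Matrix (Fin k) (Fin k) ℂ => NormedSpace.exp ((-(τ : ℂ)) • X))
    (adjGen_add_smul_eq (A := A) hdet ν ξ b)
  refine (Eq.trans (by rfl) hX).trans ?_
  rw [← transpose_smul, rauchSymbol,
    show (-(τ : ℂ)) • (A₀.map (algebraMap ℝ ℂ) * rauchGenerator A₀ A (shiftCLM A ν b) ξ *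
      (A₀⁻¹).map (algebraMap ℝ ℂ)) = A₀.map (algebraMap ℝ ℂ) *
      ((-(τ : ℂ)) • rauchGenerator A₀ A (shiftCLM A ν b) ξ) * (A₀.map (algebraMap ℝ ℂ))⁻¹ by
    rw [Matrix.mul_smul, Matrix.smul_mul, map_inv_eq_inv_map hdet],
    Matrix.exp_transpose, Matrix.exp_conj _ _ hU, ← map_inv_eq_inv_map hdet]

/-- Entries of a transposed conjugate: `|(U M U')ᵀᵢⱼ| ≤ (Σ|U|) c (Σ|U'|)` if `|M_{ab}| ≤ c`.
[folklore] -/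
theorem norm_transpose_conj_apply_le (U M U' : Matrix (Fin k) (Fin k) ℂ) {c : ℝ}
    (hM : ∀ a b, ‖M a b‖ ≤ c) (i j : Fin k) :
    ‖(U * M * U')ᵀ i j‖ ≤ (∑ a, ∑ b, ‖U a b‖) * c * ∑ a, ∑ b, ‖U' a b‖ := by
  have hc : 0 ≤ c := (norm_nonneg _).trans (hM i i)
  rw [transpose_apply, Matrix.mul_apply]
  refine (norm_sum_le _ _).trans ?_
  have h1 : ∀ b, ‖(U * M) j b * U' b i‖ ≤ (∑ a, ‖U j a‖) * c * ‖U' b i‖ := by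
    intro b
    rw [norm_mul, Matrix.mul_apply]
    refine mul_le_mul_of_nonneg_right ((norm_sum_le _ _).trans ?_) (norm_nonneg _)
    rw [Finset.sum_mul]
    refine Finset.sum_le_sum fun a _ => ?_
    rw [norm_mul]
    exact mul_le_mul_of_nonneg_left (hM a b) (norm_nonneg _)
  refine (Finset.sum_le_sum fun b _ => h1 b).trans ?_
  rw [← Finset.mul_sum]
  have hU : ∑ a, ‖U j a‖ ≤ ∑ a, ∑ b, ‖U a b‖ :=
    Finset.single_le_sum (f := fun a => ∑ b, ‖U a b‖)
      (fun a _ => Finset.sum_nonneg fun b _ => norm_nonneg _) (Finset.mem_univ j)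
  have hU' : ∑ b, ‖U' b i‖ ≤ ∑ a, ∑ b, ‖U' a b‖ := by
    calc ∑ b, ‖U' b i‖ ≤ ∑ b, ∑ b', ‖U' b b'‖ :=
          Finset.sum_le_sum fun b _ => Finset.single_le_sum (f := fun b' => ‖U' b b'‖)
            (fun b' _ => norm_nonneg _) (Finset.mem_univ i)
      _ = ∑ a, ∑ b, ‖U' a b‖ := rfl
  have h0 : 0 ≤ ∑ b, ‖U' b i‖ := Finset.sum_nonneg fun b _ => norm_nonneg _
  have h0' : 0 ≤ ∑ a, ‖U j a‖ := Finset.sum_nonneg fun a _ => norm_nonneg _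
  calc (∑ a, ‖U j a‖) * c * ∑ b, ‖U' b i‖ ≤ (∑ a, ∑ b, ‖U a b‖) * c * ∑ b, ‖U' b i‖ := by
        gcongr
    _ ≤ (∑ a, ∑ b, ‖U a b‖) * c * ∑ a, ∑ b, ‖U' a b‖ := by
        refine mul_le_mul_of_nonneg_left hU' ?_
        exact mul_nonneg (Finset.sum_nonneg fun a _ => Finset.sum_nonneg fun b _ => norm_nonneg _) hc

/-- Entry sums of a product: `Σᵢⱼ|(RM)ᵢⱼ| ≤ (Σ|R|)(Σ|M|)`. [folklore] -/
theorem sum_abs_mul_le (R M : Matrix (Fin k) (Fin k) ℝ) :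
    ∑ i, ∑ j, |(R * M) i j| ≤ (∑ i, ∑ a, |R i a|) * ∑ a, ∑ j, |M a j| := by
  calc ∑ i, ∑ j, |(R * M) i j| ≤ ∑ i, ∑ j, ∑ a, |R i a| * |M a j| := by
        refine Finset.sum_le_sum fun i _ => Finset.sum_le_sum fun j _ => ?_
        rw [Matrix.mul_apply]
        refine (Finset.abs_sum_le_sum_abs _ _).trans (le_of_eq ?_)
        exact Finset.sum_congr rfl fun a _ => abs_mul _ _
    _ = ∑ i, ∑ a, |R i a| * ∑ j, |M a j| := by
        refine Finset.sum_congr rfl fun i _ => ?_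
        rw [Finset.sum_comm]
        exact Finset.sum_congr rfl fun a _ => (Finset.mul_sum _ _ _).symm
    _ ≤ ∑ i, ∑ a, |R i a| * ∑ a', ∑ j, |M a' j| := by
        refine Finset.sum_le_sum fun i _ => Finset.sum_le_sum fun a _ => ?_
        refine mul_le_mul_of_nonneg_left ?_ (abs_nonneg _)
        exact Finset.single_le_sum (f := fun a' => ∑ j, |M a' j|)
          (fun a' _ => Finset.sum_nonneg fun j _ => abs_nonneg _) (Finset.mem_univ a)
    _ = (∑ i, ∑ a, |R i a|) * ∑ a, ∑ j, |M a j| := by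
        rw [Finset.sum_mul]
        refine Finset.sum_congr rfl fun i _ => ?_
        rw [Finset.sum_mul]

/-- Entry sums of the pencil at a vector of norm `≤ 1`: `Σ|(Σ_l ν_l A_l)ᵢⱼ| ≤ Σ_l Σ|A_l|`.
[folklore] -/
theorem sum_abs_pencil_le (A : Fin d → Matrix (Fin k) (Fin k) ℝ) {ν : Space d} (hν : ‖ν‖ ≤ 1) :
    ∑ i, ∑ j, |(∑ l, ν l • A l) i j| ≤ ∑ l, ∑ i, ∑ j, |A l i j| := by
  have hνl : ∀ l, |ν l| ≤ 1 := fun l => by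
    have h := PiLp.norm_apply_le ν l
    rw [Real.norm_eq_abs] at h
    exact h.trans hν
  calc ∑ i, ∑ j, |(∑ l, ν l • A l) i j| ≤ ∑ i, ∑ j, ∑ l, |A l i j| := by
        refine Finset.sum_le_sum fun i _ => Finset.sum_le_sum fun j _ => ?_
        rw [Matrix.sum_apply]
        refine (Finset.abs_sum_le_sum_abs _ _).trans (Finset.sum_le_sum fun l _ => ?_)
        rw [Matrix.smul_apply, smul_eq_mul, abs_mul]
        calc |ν l| * |A l i j| ≤ 1 * |A l i j| :=
              mul_le_mul_of_nonneg_right (hνl l) (abs_nonneg _)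
          _ = |A l i j| := one_mul _
    _ = ∑ i, ∑ l, ∑ j, |A l i j| :=
        Finset.sum_congr rfl fun i _ => Finset.sum_comm
    _ = ∑ l, ∑ i, ∑ j, |A l i j| := Finset.sum_comm

/-- Entry sums scale: `Σ|(r • M)ᵢⱼ| = |r| Σ|Mᵢⱼ|`. [folklore] -/
theorem sum_abs_smul (r : ℝ) (M : Matrix (Fin k) (Fin k) ℝ) :
    ∑ i, ∑ j, |(r • M) i j| = |r| * ∑ i, ∑ j, |M i j| := by
  rw [Finset.mul_sum]
  refine Finset.sum_congr rfl fun i _ => ?_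
  rw [Finset.mul_sum]
  refine Finset.sum_congr rfl fun j _ => ?_
  rw [Matrix.smul_apply, smul_eq_mul, abs_mul]

/-- `√(e^{2a} N / m) = e^{a} √(N/m)`. [folklore] -/
theorem sqrt_exp_two_mul_mul (a N m : ℝ) :
    Real.sqrt (Real.exp (2 * a) * N / m) = Real.exp a * Real.sqrt (N / m) := by
  rw [mul_div_assoc, Real.sqrt_mul (Real.exp_pos _).le, ← Real.exp_half, mul_div_cancel_left₀ _ two_ne_zero]

/-- **The pointwise bound with the zeroth-order term `B_b`**: from a symmetrizer `R` at `ξ`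
(`RA₀` symmetric with coercivity `m` and entry sum `≤ N`, `R Σξ_lA_l` symmetric, `Σ|Rᵢⱼ| ≤ K_R`)
the entries of `rauchSymbol A₀ A B_b τ ξ` are at most `√(N/m) e^{(2πK_RK_A/m)|τ||b|}`,
`K_A = Σ_l Σ|A_lᵢⱼ|`. [cite: Brenner1973, (0.3) p. 75] -/
theorem norm_rauchSymbol_shift_apply_le (hdet : A₀.det ≠ 0) {R : Matrix (Fin k) (Fin k) ℝ}
    {ξ : Space d} (hsymm₀ : (R * A₀).IsSymm) (hsymm : (R * ∑ l, ξ l • A l).IsSymm) {m N KR : ℝ}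
    (hm : 0 < m)
    (hcoer : ∀ y : Fin k → ℂ, m * ‖y‖ ^ 2 ≤ (star y ⬝ᵥ ((R * A₀).map (algebraMap ℝ ℂ) *ᵥ y)).re)
    (hN : ∑ i, ∑ j, |(R * A₀) i j| ≤ N) (hKR : ∑ i, ∑ j, |R i j| ≤ KR) {ν : Space d}
    (hν : ‖ν‖ ≤ 1) (τ b : ℝ) (a b' : Fin k) :
    ‖rauchSymbol A₀ A (shiftCLM A ν b) τ ξ a b'‖ ≤
      Real.sqrt (N / m) *
        Real.exp ((2 * Real.pi * (KR * (∑ l, ∑ i, ∑ j, |A l i j|) / m) * |τ|) * |b|) := by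
  set KA : ℝ := ∑ l, ∑ i, ∑ j, |A l i j| with hKA
  have hKR0 : 0 ≤ KR :=
    le_trans (Finset.sum_nonneg fun i _ => Finset.sum_nonneg fun j _ => abs_nonneg _) hKR
  have hKA0 : 0 ≤ KA := Finset.sum_nonneg fun l _ =>
    Finset.sum_nonneg fun i _ => Finset.sum_nonneg fun j _ => abs_nonneg _
  -- the entry sum of `R B_b`
  have hN' : ∑ i, ∑ j, |(R * LinearMap.toMatrix'
      (shiftCLM A ν b : (Fin k → ℝ) →ₗ[ℝ] (Fin k → ℝ))) i j| ≤ 2 * Real.pi * |b| * (KR * KA) := by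
    rw [toMatrix'_shiftCLM, Matrix.mul_smul, sum_abs_smul, abs_neg, abs_mul,
      abs_of_pos Real.two_pi_pos]
    refine mul_le_mul_of_nonneg_left ?_ (by positivity)
    refine (sum_abs_mul_le R _).trans ?_
    exact mul_le_mul hKR (sum_abs_pencil_le A hν)
      (Finset.sum_nonneg fun i _ => Finset.sum_nonneg fun j _ => abs_nonneg _) hKR0
  have h := norm_rauchSymbol_apply_le_of_symmetrizer hdet A (shiftCLM A ν b) hsymm₀ hsymm hm hcoer
    hN hN' τ a b'
  refine h.trans ?_
  rw [sqrt_exp_two_mul_mul, mul_comm]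
  refine mul_le_mul_of_nonneg_left (Real.exp_le_exp.2 ?_) (Real.sqrt_nonneg _)
  rw [div_le_iff₀ hm]
  have : 2 * Real.pi * (KR * KA / m) * |τ| * |b| * m = |τ| * (2 * Real.pi * |b| * (KR * KA)) := by
    field_simp
  rw [this]

/-- `A₀ᵀA₀` is symmetric positive definite when `det A₀ ≠ 0` (the symmetrizer at `ξ = 0`).
[folklore] -/
theorem posDef_transpose_mul_self (hdet : A₀.det ≠ 0) : (A₀ᵀ * A₀).PosDef := by
  have hinj : Function.Injective A₀.mulVec :=
    mulVec_injective_iff_isUnit.2 ((isUnit_iff_isUnit_det _).2 (isUnit_iff_ne_zero.2 hdet))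
  have h := Matrix.PosDef.conjTranspose_mul_self A₀ hinj
  rwa [conjTranspose_eq_transpose_of_trivial] at h

/-- **Exponential type of the deformed adjoint symbols.** For a constant-coefficient system in
Rauch's class at `0` there are `c₀, C ≥ 0` with
`|exp(L_τ ξ + ib L_τ ν)ᵢⱼ| ≤ C e^{2πc₀|τ| |b|}` for all `τ`, `ξ`, `‖ν‖ ≤ 1`, `b` — Brenner's
bound (0.3) for the complexified symbol, the principal part dropping out of the energy identity
and the frequency shift `ibν` entering as the zeroth-order term `B_b = -2πb Σν_lA_l`.
[cite: Brenner1973, (0.3) p. 75; Rauch1986, Proof of Theorem pp. 482–483] -/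
theorem exists_hasExpType_adjPencil (hS : (ofConstant A₀ A 0).IsRauchClass 0) :
    ∃ c₀ C : ℝ, 0 ≤ c₀ ∧ 0 ≤ C ∧ ∀ τ : ℝ,
      HasExpType (adjPencil A₀ A τ) C (2 * Real.pi * c₀ * |τ|) := by
  obtain ⟨hdet, R, hRc, hR⟩ := exists_continuous_symmetrizer_family hS
  set KA : ℝ := ∑ l, ∑ i, ∑ j, |A l i j| with hKA
  -- constants on the unit sphere `ζ ≠ 0`
  have hKc : IsCompact (sphere (0 : Fin d → ℝ) 1) := isCompact_sphere _ _
  have hne0 : ∀ ζ ∈ sphere (0 : Fin d → ℝ) 1, ζ ≠ 0 := fun ζ hζ h0 => by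
    rw [h0, mem_sphere_zero_iff_norm, norm_zero] at hζ; exact zero_ne_one hζ
  obtain ⟨m, N, hm, hcoer, hN⟩ := exists_uniform_quadForm_bounds (k := k) hKc
    ((hRc.fun_mul continuous_const).continuousOn) (fun ζ hζ => (hR ζ (hne0 ζ hζ)).1)
  have hcontR : ContinuousOn (fun ζ => ∑ i, ∑ j, |R ζ i j|) (sphere (0 : Fin d → ℝ) 1) :=
    (continuous_finsetSum _ fun i _ => continuous_finsetSum _ fun j _ =>
      continuous_abs.comp ((continuous_apply j).comp ((continuous_apply i).comp hRc))).continuousOn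
  obtain ⟨KR, hKR⟩ := hKc.bddAbove_image hcontR
  have hKR' : ∀ ζ ∈ sphere (0 : Fin d → ℝ) 1, ∑ i, ∑ j, |R ζ i j| ≤ KR :=
    fun ζ hζ => hKR ⟨ζ, hζ, rfl⟩
  -- constants at `ξ = 0` with the symmetrizer `A₀ᵀ`
  obtain ⟨m₀, N₀, hm₀, hcoer₀, hN₀⟩ := exists_uniform_quadForm_bounds (k := k) (X := Unit)
    (K := {()}) isCompact_singleton (Q := fun _ => A₀ᵀ * A₀) continuousOn_const
    fun _ _ => posDef_transpose_mul_self hdet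
  set K₀ : ℝ := ∑ i, ∑ j, |A₀ᵀ i j| with hK₀
  -- the conjugating matrices
  set SU : ℝ := ∑ a, ∑ b, ‖A₀.map (algebraMap ℝ ℂ) a b‖ with hSU
  set SU' : ℝ := ∑ a, ∑ b, ‖(A₀⁻¹).map (algebraMap ℝ ℂ) a b‖ with hSU'
  -- the constants
  set c₁ : ℝ := KR * KA / m with hc₁
  set c₂ : ℝ := K₀ * KA / m₀ with hc₂
  set C' : ℝ := max (Real.sqrt (N / m)) (Real.sqrt (N₀ / m₀)) with hC'
  have hC'0 : 0 ≤ C' := le_max_of_le_left (Real.sqrt_nonneg _)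
  -- nonnegativity of `c₁, c₂` (on a possibly empty sphere `KR` may be anything: clip at `0`)
  refine ⟨max (max c₁ c₂) 0, SU * C' * SU', le_max_right _ _, by positivity, fun τ ξ ν b hν i j => ?_⟩
  rw [symM_adjPencil_eq hdet]
  have key : ∀ a b', ‖rauchSymbol A₀ A (shiftCLM A ν b) τ ξ a b'‖ ≤
      C' * Real.exp (2 * Real.pi * max (max c₁ c₂) 0 * |τ| * |b|) := by
    intro a b'
    have hmono : ∀ {c S : ℝ}, c ≤ max (max c₁ c₂) 0 → S ≤ C' →
        S * Real.exp (2 * Real.pi * c * |τ| * |b|) ≤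
          C' * Real.exp (2 * Real.pi * max (max c₁ c₂) 0 * |τ| * |b|) := by
      intro c S hc hS
      refine mul_le_mul hS (Real.exp_le_exp.2 ?_) (Real.exp_pos _).le hC'0
      exact mul_le_mul_of_nonneg_right (mul_le_mul_of_nonneg_right
        (mul_le_mul_of_nonneg_left hc Real.two_pi_pos.le) (abs_nonneg τ)) (abs_nonneg b)
    rcases eq_or_ne ξ 0 with rfl | hξ
    · -- `ξ = 0`: symmetrizer `A₀ᵀ`
      have hsymm₀ : (A₀ᵀ * A₀).IsSymm := by
        show (A₀ᵀ * A₀)ᵀ = A₀ᵀ * A₀; rw [transpose_mul, transpose_transpose]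
      have hsymm : (A₀ᵀ * ∑ l, (0 : Space d) l • A l).IsSymm := by
        simp [Matrix.IsSymm]
      have h := norm_rauchSymbol_shift_apply_le (A := A) hdet hsymm₀ hsymm hm₀
        (hcoer₀ () (Set.mem_singleton _)) (hN₀ () (Set.mem_singleton _)) le_rfl hν τ b a b'
      refine h.trans ?_
      have := hmono (c := c₂) (S := Real.sqrt (N₀ / m₀))
        ((le_max_right _ _).trans (le_max_left _ _)) (le_max_right _ _)
      rw [hc₂] at this
      convert this using 2
    · -- `ξ ≠ 0`: symmetrizer `R(ζ)`, `ζ = ξ/‖ξ‖`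
      have hnξ : ‖(ξ : Fin d → ℝ)‖ ≠ 0 :=
        norm_ne_zero_iff.2 fun h0 => hξ ((WithLp.ofLp_eq_zero 2).1 h0)
      set ζ : Fin d → ℝ := ‖(ξ : Fin d → ℝ)‖⁻¹ • (ξ : Fin d → ℝ) with hζ
      have hζS : ζ ∈ sphere (0 : Fin d → ℝ) 1 := by
        rw [mem_sphere_zero_iff_norm, hζ, norm_smul, norm_inv, norm_norm, inv_mul_cancel₀ hnξ]
      have hζ0 : ζ ≠ 0 := hne0 ζ hζS
      obtain ⟨hpd, hsymm₀, hsymmζ⟩ := hR ζ hζ0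
      have hsymm : (R ζ * ∑ l, ξ l • A l).IsSymm := by
        have hsum : ∑ l, ξ l • A l = ‖(ξ : Fin d → ℝ)‖ • ∑ l, ζ l • A l := by
          rw [Finset.smul_sum]
          refine Finset.sum_congr rfl fun l _ => ?_
          rw [smul_smul, hζ, Pi.smul_apply, smul_eq_mul, ← mul_assoc, mul_inv_cancel₀ hnξ, one_mul]
        rw [hsum, Matrix.mul_smul]
        exact hsymmζ.smul _
      have h := norm_rauchSymbol_shift_apply_le (A := A) hdet hsymm₀ hsymm hm (hcoer ζ hζS)
        (hN ζ hζS) (hKR' ζ hζS) hν τ b a b'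
      refine h.trans ?_
      have := hmono (c := c₁) (S := Real.sqrt (N / m))
        ((le_max_left _ _).trans (le_max_left _ _)) (le_max_left _ _)
      rw [hc₁] at this
      convert this using 2
  refine (norm_transpose_conj_apply_le _ _ _ key i j).trans (le_of_eq ?_)
  rw [hSU, hSU']
  ring

end AdjointPencil

/-! ### The adjoint evolution as a Fourier multiplier -/

section AdjointSolution

variable {A₀ : Matrix (Fin k) (Fin k) ℝ} {A : Fin d → Matrix (Fin k) (Fin k) ℝ}

/-- The symbol of the adjoint evolution from time `t₀` to time `t`:
`M*_{t₀,t}(ξ) = exp(L_{t-t₀} ξ) = e^{(t₀-t)G*(ξ)}`. [cite: Rauch1986, Proof of Theorem p. 483] -/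
def adjSym (A₀ : Matrix (Fin k) (Fin k) ℝ) (A : Fin d → Matrix (Fin k) (Fin k) ℝ) (t₀ t : ℝ)
    (ξ : Space d) : Matrix (Fin k) (Fin k) ℂ :=
  NormedSpace.exp (adjPencil A₀ A (t - t₀) ξ)

/-- **The adjoint solution** `w(t) = M*_{t₀,t}(D)ψ`: the solution of the adjoint system
`A₀ᵀ∂ₜw + Σ Aⱼᵀ∂ⱼw = 0` with `w(t₀) = ψ`, written as a Fourier multiplier.
[cite: Rauch1986, Proof of Theorem p. 483] -/
def adjSol (A₀ : Matrix (Fin k) (Fin k) ℝ) (A : Fin d → Matrix (Fin k) (Fin k) ℝ) (t₀ : ℝ)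
    (ψ : Space d → Fin k → ℂ) (t : ℝ) (x : Space d) : Fin k → ℂ :=
  multiplierOp (adjSym A₀ A t₀ t) ψ x

/-- `M*_{t₀,t}(ξ) = exp((t₀ - t) • G*(ξ))`. [folklore] -/
theorem adjSym_eq (t₀ t : ℝ) (ξ : Space d) :
    adjSym A₀ A t₀ t ξ = NormedSpace.exp ((t₀ - t) • adjGen A₀ A ξ) := by
  rw [adjSym, adjPencil_apply, ← Complex.coe_smul]
  congr 1
  push_cast
  ring_nf

/-- At `t = t₀` the symbol is `1`. [folklore] -/
theorem adjSym_self (t₀ : ℝ) (ξ : Space d) : adjSym A₀ A t₀ t₀ ξ = 1 := by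
  rw [adjSym_eq, sub_self, zero_smul, NormedSpace.exp_zero]

/-- The symbol is continuous in `ξ`. [folklore] -/
theorem continuous_adjSym (t₀ t : ℝ) : Continuous (adjSym A₀ A t₀ t) :=
  NormedSpace.exp_continuous.comp (adjPencil A₀ A (t - t₀)).continuous

/-- Entries of the symbol are measurable in `ξ`. [folklore] -/
theorem measurable_adjSym_apply (t₀ t : ℝ) (a b : Fin k) :
    Measurable fun ξ => adjSym A₀ A t₀ t ξ a b :=
  ((continuous_apply b).comp ((continuous_apply a).comp (continuous_adjSym t₀ t))).measurable

/-- **Uniform bound**: under the exponential-type hypothesis the symbol is entrywise bounded by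
`C`, uniformly in `t₀, t, ξ`. [cite: Brenner1973, (0.3) p. 75] -/
theorem norm_adjSym_apply_le {C c₀ : ℝ}
    (hT : ∀ τ : ℝ, HasExpType (adjPencil A₀ A τ) C (2 * Real.pi * c₀ * |τ|))
    (t₀ t : ℝ) (ξ : Space d) (a b : Fin k) : ‖adjSym A₀ A t₀ t ξ a b‖ ≤ C := by
  have h := hT (t - t₀) ξ 0 0 (by simp) a b
  rw [symM_zero, abs_zero, mul_zero, Real.exp_zero, mul_one] at h
  exact h

/-- **Time derivative of the symbol**: `∂ₜ M*_{t₀,t}(ξ) = -G*(ξ) M*_{t₀,t}(ξ)`. [folklore] -/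
theorem hasDerivAt_adjSym (t₀ t : ℝ) (ξ : Space d) :
    HasDerivAt (fun s => adjSym A₀ A t₀ s ξ) (-(adjGen A₀ A ξ * adjSym A₀ A t₀ t ξ)) t := by
  have hfun : (fun s => adjSym A₀ A t₀ s ξ) =
      fun s => NormedSpace.exp ((t₀ - s) • adjGen A₀ A ξ) := funext fun s => adjSym_eq t₀ s ξ
  rw [hfun, adjSym_eq]
  have h1 := hasDerivAt_exp_smul_const' (𝕂 := ℝ) (adjGen A₀ A ξ) (t₀ - t)
  have h2 : HasDerivAt (fun s : ℝ => t₀ - s) (-1) t := by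
    simpa using (hasDerivAt_id t).const_sub t₀
  have h := h1.scomp t h2
  have h' : HasDerivAt (fun s => NormedSpace.exp ((t₀ - s) • adjGen A₀ A ξ))
      ((-1 : ℝ) • (adjGen A₀ A ξ * NormedSpace.exp ((t₀ - t) • adjGen A₀ A ξ))) t := h
  simpa using h'

/-- **Finite propagation for the adjoint solution**: if `ψ ∈ C_c^∞` is supported in `B̄(x₀, r)`
then `w(t, x) = 0` for `‖x - x₀‖ > r + c₀|t - t₀|`. [cite: Rauch1986, Proof of Theorem p. 482] -/
theorem adjSol_eq_zero {C c₀ : ℝ} (hC : 0 ≤ C) (hc₀ : 0 ≤ c₀)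
    (hT : ∀ τ : ℝ, HasExpType (adjPencil A₀ A τ) C (2 * Real.pi * c₀ * |τ|))
    {ψ : Space d → Fin k → ℂ} (hψ : ContDiff ℝ ∞ ψ) (hc : HasCompactSupport ψ) {x₀ : Space d}
    {r : ℝ} (hr : 0 ≤ r) (hsupp : tsupport ψ ⊆ closedBall x₀ r) (t₀ t : ℝ) {x : Space d}
    (hx : r + c₀ * |t - t₀| < ‖x - x₀‖) : adjSol A₀ A t₀ ψ t x = 0 := by
  have hγ : 0 ≤ 2 * Real.pi * c₀ * |t - t₀| := by positivity
  have h := multiplierOp_exp_apply_eq_zero_of_dist (hT (t - t₀)) hC hγ hψ hc hr hsupp (x := x)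
    (by rwa [show 2 * Real.pi * c₀ * |t - t₀| / (2 * Real.pi) = c₀ * |t - t₀| by
      field_simp])
  exact h

/-- A `C_c^∞` function has integrable Fourier transform. [folklore] -/
theorem integrable_fourier_of_contDiff {ψ : Space d → Fin k → ℂ} (hψ : ContDiff ℝ ∞ ψ)
    (hc : HasCompactSupport ψ) : Integrable (𝓕 ψ) := by
  have h := (𝓕 (hc.toSchwartzMap hψ)).integrable (μ := volume)
  rw [SchwartzMap.fourier_coe] at h
  exact h

/-- **`w(t₀) = ψ`** (Fourier inversion). [folklore] -/
theorem adjSol_self {ψ : Space d → Fin k → ℂ} (hψ : ContDiff ℝ ∞ ψ) (hc : HasCompactSupport ψ)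
    (t₀ : ℝ) (x : Space d) : adjSol A₀ A t₀ ψ t₀ x = ψ x := by
  rw [adjSol, multiplierOp_apply]
  have h1 : (fun ξ => adjSym A₀ A t₀ t₀ ξ *ᵥ 𝓕 ψ ξ) = 𝓕 ψ := by
    funext ξ; rw [adjSym_self, Matrix.one_mulVec]
  rw [h1, hψ.continuous.fourierInv_fourier_eq (hψ.continuous.integrable_of_hasCompactSupport hc)
    (integrable_fourier_of_contDiff hψ hc)]

/-- **Spatial derivatives of the adjoint solution**: `∂ᵥw(t) = M*_{t₀,t}(D)(∂ᵥψ)`, and `w(t)` is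
differentiable. [folklore] -/
theorem fderiv_adjSol_apply {C c₀ : ℝ} (hC : 0 ≤ C)
    (hT : ∀ τ : ℝ, HasExpType (adjPencil A₀ A τ) C (2 * Real.pi * c₀ * |τ|))
    {ψ : Space d → Fin k → ℂ} (hψ : ContDiff ℝ ∞ ψ) (hc : HasCompactSupport ψ) (t₀ t : ℝ)
    (x v : Space d) :
    fderiv ℝ (adjSol A₀ A t₀ ψ t) x v =
      multiplierOp (adjSym A₀ A t₀ t) (fun y => fderiv ℝ ψ y v) x :=
  fderiv_multiplierOp_apply_of_contDiff (measurable_adjSym_apply t₀ t) hC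
    (norm_adjSym_apply_le hT t₀ t) hψ hc x v

/-- `w(t)` is differentiable in `x`. [folklore] -/
theorem differentiable_adjSol {C c₀ : ℝ} (hC : 0 ≤ C)
    (hT : ∀ τ : ℝ, HasExpType (adjPencil A₀ A τ) C (2 * Real.pi * c₀ * |τ|))
    {ψ : Space d → Fin k → ℂ} (hψ : ContDiff ℝ ∞ ψ) (hc : HasCompactSupport ψ) (t₀ t : ℝ) :
    Differentiable ℝ (adjSol A₀ A t₀ ψ t) :=
  differentiable_multiplierOp_of_contDiff (measurable_adjSym_apply t₀ t) hC
    (norm_adjSym_apply_le hT t₀ t) hψ hc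

/-! ### The time derivative of the adjoint solution and the adjoint equation -/

/-- The Fourier-side time derivative `-(G*(ξ) M*_{t₀,t}(ξ)) 𝓕ψ(ξ)`. [folklore] -/
def adjSolDtF (A₀ : Matrix (Fin k) (Fin k) ℝ) (A : Fin d → Matrix (Fin k) (Fin k) ℝ) (t₀ : ℝ)
    (ψ : Space d → Fin k → ℂ) (t : ℝ) (ξ : Space d) : Fin k → ℂ :=
  (-(adjGen A₀ A ξ * adjSym A₀ A t₀ t ξ)) *ᵥ 𝓕 ψ ξ

/-- The time derivative of the adjoint solution, `∂ₜw(t, x) = 𝓕⁻¹[-(G* M*) 𝓕ψ](x)`.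
[folklore] -/
def adjSolDt (A₀ : Matrix (Fin k) (Fin k) ℝ) (A : Fin d → Matrix (Fin k) (Fin k) ℝ) (t₀ : ℝ)
    (ψ : Space d → Fin k → ℂ) (t : ℝ) (x : Space d) : Fin k → ℂ :=
  𝓕⁻ (adjSolDtF A₀ A t₀ ψ t) x

/-- `‖ξ‖ ‖𝓕ψ(ξ)‖` is integrable for `ψ ∈ C_c^∞` (Schwartz decay). [folklore] -/
theorem integrable_norm_mul_norm_fourier {ψ : Space d → Fin k → ℂ} (hψ : ContDiff ℝ ∞ ψ)
    (hc : HasCompactSupport ψ) : Integrable fun ξ : Space d => ‖ξ‖ * ‖𝓕 ψ ξ‖ := by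
  have h := (𝓕 (hc.toSchwartzMap hψ)).integrable_pow_mul volume 1
  simp only [pow_one] at h
  rw [SchwartzMap.fourier_coe] at h
  exact h

/-- Operator norm of the symbol: `‖M*_{t₀,t}(ξ)‖ ≤ kC`. [folklore] -/
theorem norm_adjSym_le {C c₀ : ℝ} (hC : 0 ≤ C)
    (hT : ∀ τ : ℝ, HasExpType (adjPencil A₀ A τ) C (2 * Real.pi * c₀ * |τ|))
    (t₀ t : ℝ) (ξ : Space d) : ‖adjSym A₀ A t₀ t ξ‖ ≤ k * C :=
  linfty_opNorm_le_of_entry_le hC (norm_adjSym_apply_le hT t₀ t ξ)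

/-- Pointwise bound for the Fourier-side time derivative:
`‖(G*M*)𝓕ψ(ξ)‖ ≤ K_G kC ‖ξ‖ ‖𝓕ψ(ξ)‖`. [folklore] -/
theorem norm_adjSolDtF_le {C c₀ : ℝ} (hC : 0 ≤ C)
    (hT : ∀ τ : ℝ, HasExpType (adjPencil A₀ A τ) C (2 * Real.pi * c₀ * |τ|))
    (t₀ : ℝ) (ψ : Space d → Fin k → ℂ) (t : ℝ) (ξ : Space d) :
    ‖adjSolDtF A₀ A t₀ ψ t ξ‖ ≤ adjGenBound A₀ A * (k * C) * (‖ξ‖ * ‖𝓕 ψ ξ‖) := by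
  rw [adjSolDtF]
  refine (Matrix.linfty_opNorm_mulVec _ _).trans ?_
  rw [norm_neg]
  calc ‖adjGen A₀ A ξ * adjSym A₀ A t₀ t ξ‖ * ‖𝓕 ψ ξ‖
      ≤ (adjGenBound A₀ A * ‖ξ‖) * (k * C) * ‖𝓕 ψ ξ‖ := by
        refine mul_le_mul_of_nonneg_right ((Matrix.linfty_opNorm_mul _ _).trans ?_) (norm_nonneg _)
        exact mul_le_mul (norm_adjGen_le A₀ A ξ) (norm_adjSym_le hC hT t₀ t ξ) (norm_nonneg _)
          (mul_nonneg (adjGenBound_nonneg A₀ A) (norm_nonneg _))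
    _ = adjGenBound A₀ A * (k * C) * (‖ξ‖ * ‖𝓕 ψ ξ‖) := by ring

/-- The Fourier-side time derivative is continuous in `ξ`. [folklore] -/
theorem continuous_adjSolDtF {ψ : Space d → Fin k → ℂ} (hψ : ContDiff ℝ ∞ ψ)
    (hc : HasCompactSupport ψ) (t₀ t : ℝ) : Continuous (adjSolDtF A₀ A t₀ ψ t) := by
  unfold adjSolDtF
  have h1 : Continuous fun ξ => -(adjGen A₀ A ξ * adjSym A₀ A t₀ t ξ) :=
    ((adjGen A₀ A).continuous.mul (continuous_adjSym t₀ t)).neg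
  have h2 : Continuous (𝓕 ψ) := by
    have := (𝓕 (hc.toSchwartzMap hψ)).continuous
    rwa [SchwartzMap.fourier_coe] at this
  exact (mulVecBilin (k := k)).continuous₂.comp (h1.prodMk h2)

/-- The Fourier-side time derivative is integrable. [folklore] -/
theorem integrable_adjSolDtF {C c₀ : ℝ} (hC : 0 ≤ C)
    (hT : ∀ τ : ℝ, HasExpType (adjPencil A₀ A τ) C (2 * Real.pi * c₀ * |τ|))
    {ψ : Space d → Fin k → ℂ} (hψ : ContDiff ℝ ∞ ψ) (hc : HasCompactSupport ψ) (t₀ t : ℝ) :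
    Integrable (adjSolDtF A₀ A t₀ ψ t) :=
  ((integrable_norm_mul_norm_fourier hψ hc).const_mul (adjGenBound A₀ A * (k * C))).mono'
    (continuous_adjSolDtF hψ hc t₀ t).aestronglyMeasurable
    (Eventually.of_forall fun ξ => norm_adjSolDtF_le hC hT t₀ ψ t ξ)

/-- `M*_{t₀,t} 𝓕ψ` is integrable. [folklore] -/
theorem integrable_adjSym_mulVec_fourier {C c₀ : ℝ} (hC : 0 ≤ C)
    (hT : ∀ τ : ℝ, HasExpType (adjPencil A₀ A τ) C (2 * Real.pi * c₀ * |τ|))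
    {ψ : Space d → Fin k → ℂ} (hψ : ContDiff ℝ ∞ ψ) (hc : HasCompactSupport ψ) (t₀ t : ℝ) :
    Integrable fun ξ => adjSym A₀ A t₀ t ξ *ᵥ 𝓕 ψ ξ :=
  integrable_mulVec_fourier (measurable_adjSym_apply t₀ t) hC (norm_adjSym_apply_le hT t₀ t)
    (hc.toSchwartzMap hψ)

/-- **Time derivative of the adjoint solution** (differentiation under the inverse Fourier
integral, dominated by `‖G*‖kC ‖ξ‖ ‖𝓕ψ(ξ)‖`): `∂ₜw(t, x) = 𝓕⁻¹[-(G*M*)𝓕ψ](x)`.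
[folklore] -/
theorem hasDerivAt_adjSol {C c₀ : ℝ} (hC : 0 ≤ C)
    (hT : ∀ τ : ℝ, HasExpType (adjPencil A₀ A τ) C (2 * Real.pi * c₀ * |τ|))
    {ψ : Space d → Fin k → ℂ} (hψ : ContDiff ℝ ∞ ψ) (hc : HasCompactSupport ψ) (t₀ : ℝ)
    (x : Space d) (t : ℝ) :
    HasDerivAt (fun s => adjSol A₀ A t₀ ψ s x) (adjSolDt A₀ A t₀ ψ t x) t := by
  -- the phase
  set E : Space d → ℂ := fun ξ => Complex.exp (((2 * Real.pi * ⟪ξ, x⟫ : ℝ) : ℂ) * I) with hE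
  have hEn : ∀ ξ, ‖E ξ‖ = 1 := fun ξ => by rw [hE]; exact Complex.norm_exp_ofReal_mul_I _
  have hEc : Continuous E := Complex.continuous_exp.comp ((Complex.continuous_ofReal.comp
    (continuous_const.mul (continuous_id.inner continuous_const))).mul continuous_const)
  -- the integrands
  set F : ℝ → Space d → Fin k → ℂ := fun s ξ => E ξ • (adjSym A₀ A t₀ s ξ *ᵥ 𝓕 ψ ξ) with hF
  set F' : ℝ → Space d → Fin k → ℂ := fun s ξ => E ξ • adjSolDtF A₀ A t₀ ψ s ξ with hF'
  have hψF : Continuous (𝓕 ψ) := by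
    have := (𝓕 (hc.toSchwartzMap hψ)).continuous
    rwa [SchwartzMap.fourier_coe] at this
  have hFc : ∀ s, Continuous (F s) := fun s =>
    hEc.smul ((mulVecBilin (k := k)).continuous₂.comp ((continuous_adjSym t₀ s).prodMk hψF))
  have hF'c : ∀ s, Continuous (F' s) := fun s => hEc.smul (continuous_adjSolDtF hψ hc t₀ s)
  have hFi : Integrable (F t) := by
    refine (integrable_adjSym_mulVec_fourier hC hT hψ hc t₀ t).norm.mono' (hFc t).aestronglyMeasurable
      (Eventually.of_forall fun ξ => ?_)
    rw [hF]
    simp only [norm_smul, hEn, one_mul, le_refl]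
  have key := hasDerivAt_integral_of_dominated_loc_of_deriv_le (μ := (volume : Measure (Space d)))
    (F := F) (F' := F') (x₀ := t) (s := univ) univ_mem
    (Eventually.of_forall fun s => (hFc s).aestronglyMeasurable) hFi
    (hF'c t).aestronglyMeasurable
    (Eventually.of_forall fun ξ s _ => ?_)
    ((integrable_norm_mul_norm_fourier hψ hc).const_mul (adjGenBound A₀ A * (k * C)))
    (Eventually.of_forall fun ξ s _ => ?_)
  · -- identify the integrals
    have h1 : (fun s => adjSol A₀ A t₀ ψ s x) = fun s => ∫ ξ, F s ξ := by
      funext s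
      rw [adjSol, multiplierOp_apply, Real.fourierInv_eq']
    have h2 : adjSolDt A₀ A t₀ ψ t x = ∫ ξ, F' t ξ := by
      rw [adjSolDt, Real.fourierInv_eq']
    rw [h1, h2]
    exact key.2
  · -- domination
    rw [hF', norm_smul, hEn, one_mul]
    exact norm_adjSolDtF_le hC hT t₀ ψ s ξ
  · -- pointwise derivative in `s`
    simp only [hF, hF', adjSolDtF]
    have h := hasDerivAt_smul_mulVec (hasDerivAt_const s (E ξ))
      (hasDerivAt_adjSym (A₀ := A₀) (A := A) t₀ s ξ) (hasDerivAt_const s (𝓕 ψ ξ))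
    simpa using h

/-- **The principal symbol through `A₀ᵀ`**: `A₀ᵀ_ℂ G*(ξ) = Σ_l (2πξ_l i) (A_l)ᵀ_ℂ`
(`A₀ᵀ (A₀⁻¹)ᵀ = 1`). [folklore] -/
theorem transpose_map_mul_adjGen (hdet : A₀.det ≠ 0) (ξ : Space d) :
    (A₀ᵀ).map (algebraMap ℝ ℂ) * adjGen A₀ A ξ =
      ∑ l, (2 * Real.pi * ((ξ l : ℝ) : ℂ) * I) • ((A l)ᵀ).map (algebraMap ℝ ℂ) := by
  rw [adjGen_apply, ← Matrix.mul_assoc, ← Matrix.map_mul, ← transpose_mul,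
    nonsing_inv_mul _ (isUnit_iff_ne_zero.2 hdet), transpose_one,
    Matrix.map_one _ (map_zero _) (map_one _), Matrix.one_mul]
  refine Finset.sum_congr rfl fun l _ => ?_
  congr 1
  push_cast
  ring

/-- **The adjoint equation in Fourier variables**: for every `ξ`,
`A₀ᵀ_ℂ (-(G*M*)𝓕ψ)(ξ) + Σⱼ (Aⱼ)ᵀ_ℂ M* 𝓕(∂ⱼψ)(ξ) = 0`. [cite: Rauch1986, Proof of Theorem p. 483] -/
theorem adjoint_eqn_fourierSide (hdet : A₀.det ≠ 0) {ψ : Space d → Fin k → ℂ}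
    (hψ : ContDiff ℝ ∞ ψ) (hc : HasCompactSupport ψ) (t₀ t : ℝ) (ξ : Space d) :
    (A₀ᵀ).map (algebraMap ℝ ℂ) *ᵥ adjSolDtF A₀ A t₀ ψ t ξ +
      ∑ j, ((A j)ᵀ).map (algebraMap ℝ ℂ) *ᵥ (adjSym A₀ A t₀ t ξ *ᵥ
        𝓕 (fun y => fderiv ℝ ψ y (EuclideanSpace.single j 1)) ξ) = 0 := by
  have hfd : ∀ j, 𝓕 (fun y => fderiv ℝ ψ y (EuclideanSpace.single j 1)) ξ =
      (2 * Real.pi * ξ j * Complex.I) • 𝓕 ψ ξ :=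
    fun j => fourier_fderiv_apply_single (hψ.of_le (by exact_mod_cast le_top)) hc ξ j
  simp_rw [hfd, Matrix.mulVec_smul, adjSolDtF, Matrix.mulVec_mulVec, ← Matrix.smul_mulVec,
    ← Matrix.sum_mulVec, ← Matrix.add_mulVec]
  rw [Matrix.mul_neg, ← Matrix.mul_assoc, transpose_map_mul_adjGen hdet, Finset.sum_mul,
    ← Finset.sum_neg_distrib, ← Finset.sum_add_distrib, Finset.sum_eq_zero, Matrix.zero_mulVec]
  intro l _
  rw [Matrix.smul_mul, neg_add_eq_zero]

/-- `x ↦ ∂ₜw(t, x)` is continuous. [folklore] -/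
theorem continuous_adjSolDt {C c₀ : ℝ} (hC : 0 ≤ C)
    (hT : ∀ τ : ℝ, HasExpType (adjPencil A₀ A τ) C (2 * Real.pi * c₀ * |τ|))
    {ψ : Space d → Fin k → ℂ} (hψ : ContDiff ℝ ∞ ψ) (hc : HasCompactSupport ψ) (t₀ t : ℝ) :
    Continuous (adjSolDt A₀ A t₀ ψ t) :=
  continuous_fourierInv_of_integrable (integrable_adjSolDtF hC hT hψ hc t₀ t)

/-- **The adjoint equation**: `A₀ᵀ_ℂ ∂ₜw(t, x) + Σⱼ (Aⱼ)ᵀ_ℂ ∂ⱼw(t, x) = 0` for all `t, x`.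
[cite: Rauch1986, Proof of Theorem p. 483] -/
theorem adjoint_eqn (hdet : A₀.det ≠ 0) {C c₀ : ℝ} (hC : 0 ≤ C)
    (hT : ∀ τ : ℝ, HasExpType (adjPencil A₀ A τ) C (2 * Real.pi * c₀ * |τ|))
    {ψ : Space d → Fin k → ℂ} (hψ : ContDiff ℝ ∞ ψ) (hc : HasCompactSupport ψ) (t₀ t : ℝ)
    (x : Space d) :
    (A₀ᵀ).map (algebraMap ℝ ℂ) *ᵥ adjSolDt A₀ A t₀ ψ t x +
      ∑ j, ((A j)ᵀ).map (algebraMap ℝ ℂ) *ᵥ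
        fderiv ℝ (adjSol A₀ A t₀ ψ t) x (EuclideanSpace.single j 1) = 0 := by
  -- the spatial derivatives as multiplier outputs
  have hψj : ∀ j, ContDiff ℝ ∞ fun y => fderiv ℝ ψ y (EuclideanSpace.single j 1) := fun j =>
    (hψ.fderiv_right (m := ∞) (by exact_mod_cast le_top)).clm_apply contDiff_const
  have hcj : ∀ j, HasCompactSupport fun y => fderiv ℝ ψ y (EuclideanSpace.single j 1) :=
    fun j => (hc.fderiv ℝ).comp_left (g := fun L : Space d →L[ℝ] (Fin k → ℂ) =>
      L (EuclideanSpace.single j 1)) rfl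
  set gj : Fin d → Space d → Fin k → ℂ := fun j ξ => adjSym A₀ A t₀ t ξ *ᵥ
    𝓕 (fun y => fderiv ℝ ψ y (EuclideanSpace.single j 1)) ξ with hgj
  have hgi : ∀ j, Integrable (gj j) := fun j =>
    integrable_mulVec_fourier (measurable_adjSym_apply t₀ t) hC (norm_adjSym_apply_le hT t₀ t)
      ((hcj j).toSchwartzMap (hψj j))
  have hfd : ∀ j, fderiv ℝ (adjSol A₀ A t₀ ψ t) x (EuclideanSpace.single j 1) = 𝓕⁻ (gj j) x := by
    intro j
    rw [fderiv_adjSol_apply hC hT hψ hc t₀ t x, multiplierOp_apply]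
  simp_rw [hfd]
  -- pull the constant matrices inside and add up
  have hdt := integrable_adjSolDtF hC hT hψ hc t₀ t (A₀ := A₀) (A := A)
  rw [adjSolDt, ← congrFun (fourierInv_mulVec ((A₀ᵀ).map (algebraMap ℝ ℂ)) hdt) x]
  have hsum : ∀ j, ((A j)ᵀ).map (algebraMap ℝ ℂ) *ᵥ 𝓕⁻ (gj j) x =
      𝓕⁻ (fun ξ => ((A j)ᵀ).map (algebraMap ℝ ℂ) *ᵥ gj j ξ) x :=
    fun j => (congrFun (fourierInv_mulVec (((A j)ᵀ).map (algebraMap ℝ ℂ)) (hgi j)) x).symm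
  simp_rw [hsum, Real.fourierInv_eq_fourier_neg]
  have hi1 : Integrable fun ξ => (A₀ᵀ).map (algebraMap ℝ ℂ) *ᵥ adjSolDtF A₀ A t₀ ψ t ξ := by
    simpa using (mulVecBilin ((A₀ᵀ).map (algebraMap ℝ ℂ))).integrable_comp hdt
  have hi2 : ∀ j, Integrable fun ξ => ((A j)ᵀ).map (algebraMap ℝ ℂ) *ᵥ gj j ξ := fun j => by
    simpa using (mulVecBilin (((A j)ᵀ).map (algebraMap ℝ ℂ))).integrable_comp (hgi j)
  rw [← fourier_finset_sum_apply hi2, ← fourier_add_apply hi1 (integrable_finsetSum _ fun j _ => hi2 j)]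
  have hzero : (fun ξ => (A₀ᵀ).map (algebraMap ℝ ℂ) *ᵥ adjSolDtF A₀ A t₀ ψ t ξ +
      ∑ j, ((A j)ᵀ).map (algebraMap ℝ ℂ) *ᵥ gj j ξ) = fun _ => 0 := by
    funext ξ
    exact adjoint_eqn_fourierSide hdet hψ hc t₀ t ξ
  rw [hzero]
  exact fourier_zero_apply (-x)

/-- **Uniform bound for the adjoint solution**: `‖w(t, x)‖ ≤ kC ∫‖𝓕ψ‖`. [folklore] -/
theorem norm_adjSol_le {C c₀ : ℝ} (hC : 0 ≤ C)
    (hT : ∀ τ : ℝ, HasExpType (adjPencil A₀ A τ) C (2 * Real.pi * c₀ * |τ|))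
    {ψ : Space d → Fin k → ℂ} (hψ : ContDiff ℝ ∞ ψ) (hc : HasCompactSupport ψ) (t₀ t : ℝ)
    (x : Space d) : ‖adjSol A₀ A t₀ ψ t x‖ ≤ k * C * ∫ ξ, ‖𝓕 ψ ξ‖ := by
  rw [adjSol, multiplierOp_apply, Real.fourierInv_eq']
  refine (norm_integral_le_integral_norm _).trans ?_
  rw [← integral_const_mul]
  refine integral_mono_of_nonneg (Eventually.of_forall fun ξ => norm_nonneg _)
    ((integrable_fourier_of_contDiff hψ hc).norm.const_mul _) (Eventually.of_forall fun ξ => ?_)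
  dsimp only
  rw [norm_smul, Complex.norm_exp_ofReal_mul_I, one_mul]
  exact (Matrix.linfty_opNorm_mulVec _ _).trans
    (mul_le_mul_of_nonneg_right (norm_adjSym_le hC hT t₀ t ξ) (norm_nonneg _))

/-- **Uniform bound for the time derivative**: `‖∂ₜw(t, x)‖ ≤ K_G kC ∫‖ξ‖‖𝓕ψ(ξ)‖`.
[folklore] -/
theorem norm_adjSolDt_le {C c₀ : ℝ} (hC : 0 ≤ C)
    (hT : ∀ τ : ℝ, HasExpType (adjPencil A₀ A τ) C (2 * Real.pi * c₀ * |τ|))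
    {ψ : Space d → Fin k → ℂ} (hψ : ContDiff ℝ ∞ ψ) (hc : HasCompactSupport ψ) (t₀ t : ℝ)
    (x : Space d) :
    ‖adjSolDt A₀ A t₀ ψ t x‖ ≤ adjGenBound A₀ A * (k * C) * ∫ ξ, ‖ξ‖ * ‖𝓕 ψ ξ‖ := by
  rw [adjSolDt, Real.fourierInv_eq']
  refine (norm_integral_le_integral_norm _).trans ?_
  rw [← integral_const_mul]
  refine integral_mono_of_nonneg (Eventually.of_forall fun ξ => norm_nonneg _)
    ((integrable_norm_mul_norm_fourier hψ hc).const_mul _) (Eventually.of_forall fun ξ => ?_)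
  dsimp only
  rw [norm_smul, Complex.norm_exp_ofReal_mul_I, one_mul]
  exact norm_adjSolDtF_le hC hT t₀ ψ t ξ

end AdjointSolution

/-! ### The duality argument -/

section Duality

variable {A₀ : Matrix (Fin k) (Fin k) ℝ} {A : Fin d → Matrix (Fin k) (Fin k) ℝ}

/-- The bilinear pairing `(a, z) ↦ Σᵢ aᵢzᵢ` of `ℂᵏ` with itself (real scalars, no conjugation).
[folklore] -/
def dotBilin (k : ℕ) : (Fin k → ℂ) →L[ℝ] (Fin k → ℂ) →L[ℝ] ℂ :=
  LinearMap.mkContinuous₂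
    (LinearMap.mk₂ ℝ (fun a z : Fin k → ℂ => a ⬝ᵥ z) (fun a a' z => add_dotProduct a a' z)
      (fun c a z => by rw [smul_dotProduct])
      (fun a z z' => dotProduct_add a z z') (fun c a z => by rw [dotProduct_smul]))
    k (fun a z => by
      simp only [LinearMap.mk₂_apply, dotProduct]
      refine (norm_sum_le _ _).trans ?_
      calc ∑ i, ‖a i * z i‖ ≤ ∑ _i : Fin k, ‖a‖ * ‖z‖ := Finset.sum_le_sum fun i _ => by
            rw [norm_mul]; exact mul_le_mul (norm_le_pi_norm a i) (norm_le_pi_norm z i)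
              (norm_nonneg _) (norm_nonneg _)
        _ = k * (‖a‖ * ‖z‖) := by
            rw [Finset.sum_const, Finset.card_univ, Fintype.card_fin, nsmul_eq_mul]
        _ = k * ‖a‖ * ‖z‖ := by ring)

/-- Unfolding `dotBilin`. [folklore] -/
@[simp] theorem dotBilin_apply (a z : Fin k → ℂ) : dotBilin k a z = a ⬝ᵥ z := rfl

/-- `(Ma) · z = a · (Mᵀz)`. [folklore] -/
theorem mulVec_dotProduct_eq (M : Matrix (Fin k) (Fin k) ℂ) (a z : Fin k → ℂ) :
    (M *ᵥ a) ⬝ᵥ z = a ⬝ᵥ (Mᵀ *ᵥ z) := by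
  rw [dotProduct_mulVec, vecMul_transpose]

/-- The support radius of the adjoint solution on `[0, 2t₀]`: `w(t, x) = 0` for
`‖x - x₁‖ > r + c₀t₀` and `|t - t₀| ≤ t₀`. [folklore] -/
theorem adjSol_eq_zero_of_mem {C c₀ : ℝ} (hC : 0 ≤ C) (hc₀ : 0 ≤ c₀)
    (hT : ∀ τ : ℝ, HasExpType (adjPencil A₀ A τ) C (2 * Real.pi * c₀ * |τ|))
    {ψ : Space d → Fin k → ℂ} (hψ : ContDiff ℝ ∞ ψ) (hc : HasCompactSupport ψ) {x₁ : Space d}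
    {r : ℝ} (hr : 0 ≤ r) (hsupp : tsupport ψ ⊆ closedBall x₁ r) {t₀ t : ℝ} (ht : |t - t₀| ≤ t₀)
    {x : Space d} (hx : r + c₀ * t₀ < ‖x - x₁‖) : adjSol A₀ A t₀ ψ t x = 0 :=
  adjSol_eq_zero hC hc₀ hT hψ hc hr hsupp t₀ t
    (lt_of_le_of_lt (by nlinarith) hx)

/-- Outside the support radius `r + c₀t₀` the time derivative vanishes too, for `t ∈ (0, 2t₀)`
(the slice `w(·, x)` vanishes on that neighbourhood of `t`). [folklore] -/
theorem adjSolDt_eq_zero_of_mem {C c₀ : ℝ} (hC : 0 ≤ C) (hc₀ : 0 ≤ c₀)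
    (hT : ∀ τ : ℝ, HasExpType (adjPencil A₀ A τ) C (2 * Real.pi * c₀ * |τ|))
    {ψ : Space d → Fin k → ℂ} (hψ : ContDiff ℝ ∞ ψ) (hc : HasCompactSupport ψ) {x₁ : Space d}
    {r : ℝ} (hr : 0 ≤ r) (hsupp : tsupport ψ ⊆ closedBall x₁ r) {t₀ t : ℝ} (ht : t ∈ Ioo 0 (2 * t₀))
    {x : Space d} (hx : r + c₀ * t₀ < ‖x - x₁‖) : adjSolDt A₀ A t₀ ψ t x = 0 := by
  -- `w(·, x)` vanishes on the neighbourhood `(0, 2t₀)` of `t`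
  have hzero : ∀ s ∈ Ioo 0 (2 * t₀), adjSol A₀ A t₀ ψ s x = 0 := fun s hs =>
    adjSol_eq_zero_of_mem hC hc₀ hT hψ hc hr hsupp (abs_sub_le_iff.2 ⟨by linarith [hs.2], by
      linarith [hs.1]⟩) hx
  have hev : (fun s => adjSol A₀ A t₀ ψ s x) =ᶠ[𝓝 t] fun _ => 0 :=
    Filter.eventuallyEq_of_mem (Ioo_mem_nhds ht.1 ht.2) fun s hs => hzero s hs
  have h0 : HasDerivAt (fun s => adjSol A₀ A t₀ ψ s x) 0 t :=
    (hasDerivAt_const t (0 : Fin k → ℂ)).congr_of_eventuallyEq hev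
  exact (hasDerivAt_adjSol hC hT hψ hc t₀ x t).unique h0

/-- `x ↦ ∂ⱼw(t, x)` is continuous (a multiplier output). [folklore] -/
theorem continuous_fderiv_adjSol_apply {C c₀ : ℝ} (hC : 0 ≤ C)
    (hT : ∀ τ : ℝ, HasExpType (adjPencil A₀ A τ) C (2 * Real.pi * c₀ * |τ|))
    {ψ : Space d → Fin k → ℂ} (hψ : ContDiff ℝ ∞ ψ) (hc : HasCompactSupport ψ) (t₀ t : ℝ)
    (v : Space d) : Continuous fun x => fderiv ℝ (adjSol A₀ A t₀ ψ t) x v := by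
  have hψv : ContDiff ℝ ∞ fun y => fderiv ℝ ψ y v :=
    (hψ.fderiv_right (m := ∞) (by exact_mod_cast le_top)).clm_apply contDiff_const
  have hcv : HasCompactSupport fun y => fderiv ℝ ψ y v :=
    (hc.fderiv ℝ).comp_left (g := fun L : Space d →L[ℝ] (Fin k → ℂ) => L v) rfl
  have hfun : (fun x => fderiv ℝ (adjSol A₀ A t₀ ψ t) x v) =
      multiplierOp (adjSym A₀ A t₀ t) (fun y => fderiv ℝ ψ y v) :=
    funext fun x => fderiv_adjSol_apply hC hT hψ hc t₀ t x v
  rw [hfun, multiplierOp_apply]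
  exact continuous_fourierInv_of_integrable (integrable_mulVec_fourier (measurable_adjSym_apply t₀ t)
    hC (norm_adjSym_apply_le hT t₀ t) (hcv.toSchwartzMap hψv))

/-- **Integration by parts in `x`** for the pairing of a `C¹` field `f` with the adjoint
solution (compactly supported in `x`): `∫ (Aⱼf)·∂ⱼw = -∫ (Aⱼ∂ⱼf)·w`. [folklore] -/
theorem integral_pair_fderiv_adjSol {C c₀ : ℝ} (hC : 0 ≤ C)
    (hT : ∀ τ : ℝ, HasExpType (adjPencil A₀ A τ) C (2 * Real.pi * c₀ * |τ|))
    {ψ : Space d → Fin k → ℂ} (hψ : ContDiff ℝ ∞ ψ) (hc : HasCompactSupport ψ) (t₀ t : ℝ)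
    (hw : HasCompactSupport (adjSol A₀ A t₀ ψ t)) {f : Space d → Fin k → ℂ} (hf : ContDiff ℝ 1 f)
    (M : Matrix (Fin k) (Fin k) ℂ) (j : Fin d) :
    ∫ x, (M *ᵥ f x) ⬝ᵥ fderiv ℝ (adjSol A₀ A t₀ ψ t) x (EuclideanSpace.single j 1) =
      -∫ x, (M *ᵥ fderiv ℝ f x (EuclideanSpace.single j 1)) ⬝ᵥ adjSol A₀ A t₀ ψ t x := by
  set w := adjSol A₀ A t₀ ψ t with hwdef
  set e : Space d := EuclideanSpace.single j 1 with he
  have hfd : Differentiable ℝ f := hf.differentiable one_ne_zero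
  have hfc : Continuous f := hf.continuous
  have hf'c : Continuous fun x => fderiv ℝ f x e :=
    (hf.continuous_fderiv one_ne_zero).clm_apply continuous_const
  have hwc : Continuous w := (differentiable_adjSol hC hT hψ hc t₀ t).continuous
  have hw'c : Continuous fun x => fderiv ℝ w x e := continuous_fderiv_adjSol_apply hC hT hψ hc t₀ t e
  have hw' : HasCompactSupport fun x => fderiv ℝ w x e :=
    (hw.fderiv ℝ).comp_left (g := fun L : Space d →L[ℝ] (Fin k → ℂ) => L e) rfl
  have hMc : ∀ {g : Space d → Fin k → ℂ}, Continuous g → Continuous fun x => M *ᵥ g x :=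
    fun hg => (mulVecBilin M).continuous.comp hg
  have h := integral_bilinear_hasLineDerivAt_right_eq_neg_left_of_integrable
    (μ := (volume : Measure (Space d))) (f := fun x => M *ᵥ f x)
    (f' := fun x => M *ᵥ fderiv ℝ f x e) (g := w) (g' := fun x => fderiv ℝ w x e) (v := e)
    (B := dotBilin k) ?_ ?_ ?_ ?_ ?_
  · simpa using h
  · -- `B(f', g)` integrable: continuous with compact support
    exact ((dotBilin k).continuous₂.comp ((hMc hf'c).prodMk hwc)).integrable_of_hasCompactSupport
      (hw.mono fun x hx => by
        rw [Function.mem_support] at hx ⊢; contrapose! hx; simp [hx])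
  · exact ((dotBilin k).continuous₂.comp ((hMc hfc).prodMk hw'c)).integrable_of_hasCompactSupport
      (hw'.mono fun x hx => by
        rw [Function.mem_support] at hx ⊢; contrapose! hx; simp [hx])
  · exact ((dotBilin k).continuous₂.comp ((hMc hfc).prodMk hwc)).integrable_of_hasCompactSupport
      (hw.mono fun x hx => by
        rw [Function.mem_support] at hx ⊢; contrapose! hx; simp [hx])
  · intro x _
    have h1 : HasFDerivAt (fun x => M *ᵥ f x) ((mulVecBilin M).comp (fderiv ℝ f x)) x :=
      (mulVecBilin M).hasFDerivAt.comp x (hfd x).hasFDerivAt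
    exact h1.hasLineDerivAt e
  · intro x _
    exact ((differentiable_adjSol hC hT hψ hc t₀ t) x).hasFDerivAt.hasLineDerivAt e

/-! ### The pairing `P(t) = ∫ (A₀u)·w` and its constancy -/

variable {T : ℝ} {u : ℝ → Space d → Fin k → ℝ}

/-- The complexified pairing integrand `(A₀)_ℂ u_ℂ(t, x) · w(t, x)`. [folklore] -/
def pairF (A₀ : Matrix (Fin k) (Fin k) ℝ) (A : Fin d → Matrix (Fin k) (Fin k) ℝ)
    (u : ℝ → Space d → Fin k → ℝ) (t₀ : ℝ) (ψ : Space d → Fin k → ℂ) (t : ℝ) (x : Space d) : ℂ :=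
  (A₀.map (algebraMap ℝ ℂ) *ᵥ cplx (u t) x) ⬝ᵥ adjSol A₀ A t₀ ψ t x

/-- Its time derivative `(A₀)_ℂ ∂ₜu_ℂ · w + (A₀)_ℂ u_ℂ · ∂ₜw`. [folklore] -/
def pairF' (A₀ : Matrix (Fin k) (Fin k) ℝ) (A : Fin d → Matrix (Fin k) (Fin k) ℝ)
    (u : ℝ → Space d → Fin k → ℝ) (t₀ : ℝ) (ψ : Space d → Fin k → ℂ) (t : ℝ) (x : Space d) : ℂ :=
  (A₀.map (algebraMap ℝ ℂ) *ᵥ Literature.Analysis.Fourier.timeDeriv (fun s => cplx (u s)) t x) ⬝ᵥ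
      adjSol A₀ A t₀ ψ t x +
    (A₀.map (algebraMap ℝ ℂ) *ᵥ cplx (u t) x) ⬝ᵥ adjSolDt A₀ A t₀ ψ t x

/-- **The pointwise identity behind `P' = 0`**: at interior times, by the equation for `u` and the
adjoint equation for `w`,
`(A₀∂ₜu)·w + (A₀u)·∂ₜw = -Σⱼ [(Aⱼ∂ⱼu)·w + (Aⱼu)·∂ⱼw]`. [cite: Rauch1986, Proof of Theorem p. 483] -/
theorem pairF'_eq (hu : (ofConstant A₀ A 0).IsClassicalSolution T u) (hdet : A₀.det ≠ 0)
    {C c₀ : ℝ} (hC : 0 ≤ C) (hT : ∀ τ : ℝ, HasExpType (adjPencil A₀ A τ) C (2 * Real.pi * c₀ * |τ|))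
    {ψ : Space d → Fin k → ℂ} (hψ : ContDiff ℝ ∞ ψ) (hc : HasCompactSupport ψ) (t₀ : ℝ) {t : ℝ}
    (ht : t ∈ Ioo 0 T) (x : Space d) :
    pairF' A₀ A u t₀ ψ t x =
      -∑ j, (((A j).map (algebraMap ℝ ℂ) *ᵥ fderiv ℝ (cplx (u t)) x (EuclideanSpace.single j 1)) ⬝ᵥ
          adjSol A₀ A t₀ ψ t x +
        ((A j).map (algebraMap ℝ ℂ) *ᵥ cplx (u t) x) ⬝ᵥ
          fderiv ℝ (adjSol A₀ A t₀ ψ t) x (EuclideanSpace.single j 1)) := by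
  -- the equation for `u`, complexified (zeroth-order term `0`)
  have hu' := eqn_cplx hu ht x
  have hB0 : (LinearMap.toMatrix' ((0 : (Fin k → ℝ) →L[ℝ] (Fin k → ℝ)) :
      (Fin k → ℝ) →ₗ[ℝ] (Fin k → ℝ))).map (algebraMap ℝ ℂ) = 0 := by
    ext i j
    simp
  rw [hB0, Matrix.zero_mulVec, add_zero] at hu'
  have h1 : A₀.map (algebraMap ℝ ℂ) *ᵥ Literature.Analysis.Fourier.timeDeriv (fun s => cplx (u s)) t x =
      -∑ j, (A j).map (algebraMap ℝ ℂ) *ᵥ fderiv ℝ (cplx (u t)) x (EuclideanSpace.single j 1) :=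
    eq_neg_of_add_eq_zero_left hu'
  -- the adjoint equation for `w`
  have h2 : (A₀ᵀ).map (algebraMap ℝ ℂ) *ᵥ adjSolDt A₀ A t₀ ψ t x =
      -∑ j, ((A j)ᵀ).map (algebraMap ℝ ℂ) *ᵥ
        fderiv ℝ (adjSol A₀ A t₀ ψ t) x (EuclideanSpace.single j 1) :=
    eq_neg_of_add_eq_zero_left (adjoint_eqn hdet hC hT hψ hc t₀ t x)
  rw [pairF', h1, mulVec_dotProduct_eq (A₀.map (algebraMap ℝ ℂ)), ← transpose_map, h2,
    neg_dotProduct, dotProduct_neg, ← neg_add, sum_dotProduct, dotProduct_sum,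
    ← Finset.sum_add_distrib]
  congr 1
  refine Finset.sum_congr rfl fun j _ => ?_
  rw [transpose_map, ← mulVec_dotProduct_eq]

/-- **`∫ P'(t) = 0` integrand-wise**: at interior times, if `w(t)` is compactly supported,
`∫ [(A₀∂ₜu)·w + (A₀u)·∂ₜw] dx = 0` (integrate the identity `pairF'_eq` by parts in `x`).
[cite: Rauch1986, Proof of Theorem p. 483] -/
theorem integral_pairF'_eq_zero (hu : (ofConstant A₀ A 0).IsClassicalSolution T u)
    (hdet : A₀.det ≠ 0) {C c₀ : ℝ} (hC : 0 ≤ C)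
    (hT : ∀ τ : ℝ, HasExpType (adjPencil A₀ A τ) C (2 * Real.pi * c₀ * |τ|))
    {ψ : Space d → Fin k → ℂ} (hψ : ContDiff ℝ ∞ ψ) (hc : HasCompactSupport ψ) (t₀ : ℝ) {t : ℝ}
    (ht : t ∈ Ioo 0 T) (hw : HasCompactSupport (adjSol A₀ A t₀ ψ t)) :
    ∫ x, pairF' A₀ A u t₀ ψ t x = 0 := by
  have huc : ContDiff ℝ 1 (cplx (u t)) := contDiff_cplx_slice hu (Ioo_subset_Icc_self ht)
  set w := adjSol A₀ A t₀ ψ t with hwdef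
  set e : Fin d → Space d := fun j => EuclideanSpace.single j 1 with he
  -- the two families of integrands
  set f1 : Fin d → Space d → ℂ := fun j x =>
    ((A j).map (algebraMap ℝ ℂ) *ᵥ fderiv ℝ (cplx (u t)) x (e j)) ⬝ᵥ w x with hf1
  set f2 : Fin d → Space d → ℂ := fun j x =>
    ((A j).map (algebraMap ℝ ℂ) *ᵥ cplx (u t) x) ⬝ᵥ fderiv ℝ w x (e j) with hf2
  have hIBP : ∀ j, ∫ x, f2 j x = -∫ x, f1 j x := fun j =>
    integral_pair_fderiv_adjSol hC hT hψ hc t₀ t hw huc _ j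
  -- integrability (continuous with compact support)
  have hwc : Continuous w := (differentiable_adjSol hC hT hψ hc t₀ t).continuous
  have hw'c : ∀ j, Continuous fun x => fderiv ℝ w x (e j) := fun j =>
    continuous_fderiv_adjSol_apply hC hT hψ hc t₀ t (e j)
  have hw' : ∀ j, HasCompactSupport fun x => fderiv ℝ w x (e j) := fun j =>
    (hw.fderiv ℝ).comp_left (g := fun L : Space d →L[ℝ] (Fin k → ℂ) => L (e j)) rfl
  have hMc : ∀ (M : Matrix (Fin k) (Fin k) ℂ) {g : Space d → Fin k → ℂ}, Continuous g →
      Continuous fun x => M *ᵥ g x := fun M _ hg => (mulVecBilin M).continuous.comp hg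
  have hi1 : ∀ j, Integrable (f1 j) := fun j =>
    ((dotBilin k).continuous₂.comp ((hMc _ ((huc.continuous_fderiv one_ne_zero).clm_apply
      continuous_const)).prodMk hwc)).integrable_of_hasCompactSupport
      (hw.mono fun x hx => by
        rw [Function.mem_support] at hx ⊢; contrapose! hx; simp [hx])
  have hi2 : ∀ j, Integrable (f2 j) := fun j =>
    ((dotBilin k).continuous₂.comp ((hMc _ huc.continuous).prodMk (hw'c j))).integrable_of_hasCompactSupport
      ((hw' j).mono fun x hx => by
        rw [Function.mem_support] at hx ⊢; contrapose! hx; simp [hx])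
  have hfun : (fun x => pairF' A₀ A u t₀ ψ t x) = fun x => -∑ j, (f1 j x + f2 j x) := by
    funext x
    exact pairF'_eq hu hdet hC hT hψ hc t₀ ht x
  have hsum : ∫ a, ∑ j, (f1 j a + f2 j a) = ∑ j, ∫ a, (f1 j a + f2 j a) :=
    integral_finsetSum _ fun j _ => (hi1 j).add (hi2 j)
  rw [hfun, integral_neg, hsum, neg_eq_zero]
  refine Finset.sum_eq_zero fun j _ => ?_
  rw [integral_add (hi1 j) (hi2 j), hIBP j, add_neg_cancel]

/-- `‖a · z‖ ≤ k ‖a‖ ‖z‖` (sup norms). [folklore] -/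
theorem norm_dotProduct_le' (a z : Fin k → ℂ) : ‖a ⬝ᵥ z‖ ≤ k * ‖a‖ * ‖z‖ := by
  have h := (dotBilin k).le_opNorm₂ a z
  have hB : ‖dotBilin k‖ ≤ k :=
    LinearMap.mkContinuous₂_norm_le _ (Nat.cast_nonneg k) _
  rw [dotBilin_apply] at h
  exact h.trans (mul_le_mul_of_nonneg_right (mul_le_mul_of_nonneg_right hB (norm_nonneg _))
    (norm_nonneg _))
set_option maxHeartbeats 400000 in -- buildfix (bf3-g27): 160k/180k FAIL, 200k PASS at accept time; line-neutral budget line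
/-- **The duality identity `P(t₀) = P(0)`.** For a classical solution `u` of the constant-coefficient
system on `[0, T]`, `0 < t₀ ≤ T`, and `ψ ∈ C_c^∞` supported in `B̄(x₁, r)`:
`∫ (A₀u(t₀))·w(t₀) dx = ∫ (A₀u(0))·w(0) dx`, `w` the adjoint solution with `w(t₀) = ψ`
(`P` is continuous on `[0, t₀]` and `P' = 0` on `(0, t₀)`: differentiation under the integral
sign, dominated on the compact support of `w`, and `integral_pairF'_eq_zero`).
[cite: Rauch1986, Proof of Theorem p. 483] -/
theorem integral_pairF_eq (hu : (ofConstant A₀ A 0).IsClassicalSolution T u) (hdet : A₀.det ≠ 0)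
    {C c₀ : ℝ} (hC : 0 ≤ C) (hc₀ : 0 ≤ c₀)
    (hT : ∀ τ : ℝ, HasExpType (adjPencil A₀ A τ) C (2 * Real.pi * c₀ * |τ|))
    {ψ : Space d → Fin k → ℂ} (hψ : ContDiff ℝ ∞ ψ) (hc : HasCompactSupport ψ) {x₁ : Space d}
    {r : ℝ} (hr : 0 ≤ r) (hsupp : tsupport ψ ⊆ closedBall x₁ r) {t₀ : ℝ} (ht₀ : 0 < t₀)
    (ht₀T : t₀ ≤ T) :
    ∫ x, pairF A₀ A u t₀ ψ t₀ x = ∫ x, pairF A₀ A u t₀ ψ 0 x := by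
  -- notation
  set uc : ℝ → Space d → Fin k → ℂ := fun s => cplx (u s) with huc
  set Mℂ : Matrix (Fin k) (Fin k) ℂ := A₀.map (algebraMap ℝ ℂ) with hMℂ
  set K : Set (Space d) := closedBall x₁ (r + c₀ * t₀) with hK
  have hKc : IsCompact K := isCompact_closedBall _ _
  set P : ℝ → ℂ := fun t => ∫ x, pairF A₀ A u t₀ ψ t x with hP
  -- regularity of `u_ℂ` on the slab
  have hdiff : ContDiffOn ℝ 1 (Function.uncurry uc) (Icc 0 T ×ˢ univ) := contDiffOn_uncurry_cplx hu
  have hcontT : ContinuousOn (Function.uncurry uc) (Icc 0 T ×ˢ univ) := hdiff.continuousOn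
  have hslice : ∀ t ∈ Icc 0 T, Continuous (uc t) := fun t ht =>
    (contDiff_cplx_slice hu ht).continuous
  -- support of `w(t)` for `|t - t₀| ≤ t₀`
  have hwK : ∀ t, |t - t₀| ≤ t₀ → ∀ x, x ∉ K → adjSol A₀ A t₀ ψ t x = 0 := fun t ht x hx =>
    adjSol_eq_zero_of_mem hC hc₀ hT hψ hc hr hsupp ht (by
      rwa [hK, mem_closedBall, dist_eq_norm, not_le] at hx)
  have hwcs : ∀ t, |t - t₀| ≤ t₀ → HasCompactSupport (adjSol A₀ A t₀ ψ t) := fun t ht =>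
    HasCompactSupport.intro hKc (hwK t ht)
  have hwc : ∀ t, Continuous (adjSol A₀ A t₀ ψ t) := fun t => (differentiable_adjSol hC hT hψ hc t₀ t).continuous
  -- uniform bounds for `w` and `∂ₜw`
  set Bw : ℝ := k * C * ∫ ξ, ‖𝓕 ψ ξ‖ with hBw
  set Bdt : ℝ := adjGenBound A₀ A * (k * C) * ∫ ξ, ‖ξ‖ * ‖𝓕 ψ ξ‖ with hBdt
  have hBw' : ∀ t x, ‖adjSol A₀ A t₀ ψ t x‖ ≤ Bw := fun t x => norm_adjSol_le hC hT hψ hc t₀ t x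
  have hBdt' : ∀ t x, ‖adjSolDt A₀ A t₀ ψ t x‖ ≤ Bdt := fun t x => norm_adjSolDt_le hC hT hψ hc t₀ t x
  -- the integrand is continuous in `x` and compactly supported
  have hFc : ∀ t ∈ Icc 0 T, Continuous (pairF A₀ A u t₀ ψ t) := fun t ht =>
    (dotBilin k).continuous₂.comp (((mulVecBilin Mℂ).continuous.comp (hslice t ht)).prodMk (hwc t))
  -- (1) continuity of `P` on `[0, t₀]`
  obtain ⟨Bu, hBu⟩ := (isCompact_Icc.prod hKc).exists_bound_of_continuousOn
    (f := Function.uncurry uc) (hcontT.mono (prod_mono (Icc_subset_Icc_right ht₀T) (subset_univ _)))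
  have hPcont : ContinuousOn P (Icc 0 t₀) := by
    refine continuousOn_of_dominated (bound := K.indicator fun _ => k * (‖Mℂ‖ * Bu) * Bw)
      (fun t ht => (hFc t (Icc_subset_Icc_right ht₀T ht)).aestronglyMeasurable)
      (fun t ht => Eventually.of_forall fun x => ?_) ?_ (Eventually.of_forall fun x => ?_)
    · -- the bound
      by_cases hx : x ∈ K
      · rw [indicator_of_mem hx, pairF]
        refine (norm_dotProduct_le' _ _).trans ?_
        have h1 : ‖Mℂ *ᵥ cplx (u t) x‖ ≤ ‖Mℂ‖ * Bu :=
          (Matrix.linfty_opNorm_mulVec _ _).trans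
            (mul_le_mul_of_nonneg_left (hBu (t, x) ⟨ht, hx⟩) (norm_nonneg _))
        have h0 : 0 ≤ ‖Mℂ‖ * Bu := le_trans (by positivity) h1
        exact mul_le_mul (mul_le_mul_of_nonneg_left h1 (Nat.cast_nonneg k)) (hBw' t x)
          (norm_nonneg _) (by positivity)
      · rw [indicator_of_notMem hx, pairF, hwK t (abs_sub_le_iff.2 ⟨by linarith [ht.2], by
          linarith [ht.1]⟩) x hx, dotProduct_zero, norm_zero]
    · exact (integrableOn_const (hKc.measure_lt_top).ne).integrable_indicator hKc.measurableSet
    · -- continuity in `t` for fixed `x`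
      have h1 : ContinuousOn (fun t => uc t x) (Icc 0 t₀) :=
        (hcontT.comp (continuous_id.prodMk continuous_const).continuousOn fun t ht =>
          ⟨Icc_subset_Icc_right ht₀T ht, mem_univ x⟩)
      have h2 : Continuous fun t => adjSol A₀ A t₀ ψ t x := continuous_iff_continuousAt.2 fun t =>
        (hasDerivAt_adjSol hC hT hψ hc t₀ x t).continuousAt
      exact (dotBilin k).continuous₂.comp_continuousOn
        ((((mulVecBilin Mℂ).continuous.comp_continuousOn h1)).prodMk h2.continuousOn)
  -- (2) `P' = 0` on `(0, t₀)`
  have hPderiv : ∀ t₁ ∈ Ioo 0 t₀, HasDerivAt P 0 t₁ := by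
    intro t₁ ht₁
    set a : ℝ := t₁ / 2 with ha
    set b : ℝ := (t₁ + t₀) / 2 with hb
    have ha0 : 0 < a := by rw [ha]; linarith [ht₁.1]
    have hab : a < t₁ ∧ t₁ < b := ⟨by rw [ha]; linarith [ht₁.1], by rw [hb]; linarith [ht₁.2]⟩
    have hbT : b < T := by rw [hb]; linarith [ht₁.2]
    have hbt₀ : b < t₀ := by rw [hb]; linarith [ht₁.2]
    have hsub : Icc a b ⊆ Ioo 0 T := fun t ht => ⟨ha0.trans_le ht.1, ht.2.trans_lt hbT⟩
    -- bounds for `u_ℂ` and `∂ₜu_ℂ` on `[a, b] × K`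
    obtain ⟨Bu₁, hBu₁⟩ := (isCompact_Icc.prod hKc).exists_bound_of_continuousOn
      (f := Function.uncurry uc)
      (hcontT.mono (prod_mono (fun t ht => Ioo_subset_Icc_self (hsub ht)) (subset_univ _)))
    have ho : IsOpen (Ioo 0 T ×ˢ (univ : Set (Space d))) := isOpen_Ioo.prod isOpen_univ
    have hcD : ContinuousOn (fderiv ℝ (Function.uncurry uc)) (Ioo 0 T ×ˢ univ) :=
      (hdiff.mono (prod_mono Ioo_subset_Icc_self subset_rfl)).continuousOn_fderiv_of_isOpen ho le_rfl
    have hcDt : ContinuousOn (fun p : ℝ × Space d => Literature.Analysis.Fourier.timeDeriv uc p.1 p.2)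
        (Ioo 0 T ×ˢ univ) :=
      (ContinuousLinearMap.apply ℝ (Fin k → ℂ) ((1 : ℝ), (0 : Space d))).continuous.comp_continuousOn hcD
    obtain ⟨Bu₂, hBu₂⟩ := (isCompact_Icc.prod hKc).exists_bound_of_continuousOn
      (hcDt.mono (prod_mono hsub (subset_univ _)))
    set F' : ℝ → Space d → ℂ := fun t x => pairF' A₀ A u t₀ ψ t x with hF'
    have key := hasDerivAt_integral_of_dominated_loc_of_deriv_le (μ := (volume : Measure (Space d)))
      (F := fun t x => pairF A₀ A u t₀ ψ t x) (F' := F') (x₀ := t₁) (s := Ioo a b)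
      (bound := K.indicator fun _ => k * (‖Mℂ‖ * Bu₂) * Bw + k * (‖Mℂ‖ * Bu₁) * Bdt)
      (Ioo_mem_nhds hab.1 hab.2) ?_ ?_ ?_ ?_ ?_ ?_
    · have hint : ∫ x, F' t₁ x = 0 :=
        integral_pairF'_eq_zero hu hdet hC hT hψ hc t₀ ⟨ht₁.1, ht₁.2.trans_le ht₀T⟩
          (hwcs t₁ (abs_sub_le_iff.2 ⟨by linarith [ht₁.2], by linarith [ht₁.1]⟩))
      have h := key.2
      rwa [hint] at h
    · exact Filter.eventually_of_mem (Ioo_mem_nhds hab.1 hab.2) fun t ht =>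
        (hFc t (Ioo_subset_Icc_self (hsub (Ioo_subset_Icc_self ht)))).aestronglyMeasurable
    · -- integrability of `F t₁`
      exact (hFc t₁ ⟨ht₁.1.le, ht₁.2.le.trans ht₀T⟩).integrable_of_hasCompactSupport
        ((hwcs t₁ (abs_sub_le_iff.2 ⟨by linarith [ht₁.2], by linarith [ht₁.1]⟩)).mono fun x hx => by
          rw [Function.mem_support] at hx ⊢; contrapose! hx; simp [pairF, hx])
    · -- measurability of `F' t₁`
      have h1 : Continuous fun x => Literature.Analysis.Fourier.timeDeriv uc t₁ x :=
        (hcDt.comp_continuous (continuous_const.prodMk continuous_id) fun x =>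
          ⟨⟨ht₁.1, ht₁.2.trans_le ht₀T⟩, mem_univ x⟩ :)
      have h2 := hslice t₁ ⟨ht₁.1.le, ht₁.2.le.trans ht₀T⟩
      have h3 := continuous_adjSolDt hC hT hψ hc t₀ t₁ (A₀ := A₀) (A := A)
      refine Continuous.aestronglyMeasurable ?_
      show Continuous fun x => pairF' A₀ A u t₀ ψ t₁ x
      unfold pairF'
      exact ((dotBilin k).continuous₂.comp (((mulVecBilin Mℂ).continuous.comp h1).prodMk (hwc t₁))).add
        ((dotBilin k).continuous₂.comp (((mulVecBilin Mℂ).continuous.comp h2).prodMk h3))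
    · -- domination on `(a, b)`
      refine Eventually.of_forall fun x t ht => ?_
      have ht' : |t - t₀| ≤ t₀ := abs_sub_le_iff.2 ⟨by linarith [ht.2], by linarith [ht.1]⟩
      by_cases hx : x ∈ K
      · rw [indicator_of_mem hx, hF']
        simp only [pairF']
        refine (norm_add_le _ _).trans (add_le_add ?_ ?_)
        · refine (norm_dotProduct_le' _ _).trans ?_
          have h1 : ‖Mℂ *ᵥ Literature.Analysis.Fourier.timeDeriv uc t x‖ ≤ ‖Mℂ‖ * Bu₂ :=
            (Matrix.linfty_opNorm_mulVec _ _).trans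
              (mul_le_mul_of_nonneg_left (hBu₂ (t, x) ⟨Ioo_subset_Icc_self ht, hx⟩) (norm_nonneg _))
          have h0 : 0 ≤ ‖Mℂ‖ * Bu₂ := le_trans (by positivity) h1
          exact mul_le_mul (mul_le_mul_of_nonneg_left h1 (Nat.cast_nonneg k)) (hBw' t x)
            (norm_nonneg _) (by positivity)
        · refine (norm_dotProduct_le' _ _).trans ?_
          have h1 : ‖Mℂ *ᵥ cplx (u t) x‖ ≤ ‖Mℂ‖ * Bu₁ :=
            (Matrix.linfty_opNorm_mulVec _ _).trans
              (mul_le_mul_of_nonneg_left (hBu₁ (t, x) ⟨Ioo_subset_Icc_self ht, hx⟩) (norm_nonneg _))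
          have h0 : 0 ≤ ‖Mℂ‖ * Bu₁ := le_trans (by positivity) h1
          exact mul_le_mul (mul_le_mul_of_nonneg_left h1 (Nat.cast_nonneg k)) (hBdt' t x)
            (norm_nonneg _) (by positivity)
      · rw [indicator_of_notMem hx, hF']
        simp only [pairF']
        rw [hwK t ht' x hx, adjSolDt_eq_zero_of_mem hC hc₀ hT hψ hc hr hsupp
          ⟨ha0.trans ht.1, by linarith [ht.2]⟩ (by rwa [hK, mem_closedBall, dist_eq_norm, not_le] at hx),
          dotProduct_zero, dotProduct_zero, add_zero, norm_zero]
    · exact (integrableOn_const (hKc.measure_lt_top).ne).integrable_indicator hKc.measurableSet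
    · -- pointwise derivative in `t`
      refine Eventually.of_forall fun x t ht => ?_
      have htT : t ∈ Ioo 0 T := hsub (Ioo_subset_Icc_self ht)
      have hU : HasDerivAt (fun s => Mℂ *ᵥ uc s x)
          (Mℂ *ᵥ Literature.Analysis.Fourier.timeDeriv uc t x) t :=
        (mulVecBilin Mℂ).hasFDerivAt.comp_hasDerivAt t
          (Literature.Analysis.Fourier.hasDerivAt_slice hdiff htT x)
      have hW := hasDerivAt_adjSol hC hT hψ hc t₀ x t (A₀ := A₀) (A := A)
      have h := (dotBilin k).hasDerivAt_of_bilinear (fun _ => hU) (fun _ => hW)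
      refine h.congr_deriv ?_
      simp only [dotBilin_apply, hF', pairF']
      exact add_comm _ _
  -- (3) constancy on `(0, t₀)` and passage to the endpoints
  have hconst : ∀ s₁ ∈ Ioo 0 t₀, ∀ s₂ ∈ Ioo 0 t₀, P s₁ = P s₂ := fun s₁ hs₁ s₂ hs₂ =>
    isOpen_Ioo.is_const_of_deriv_eq_zero isPreconnected_Ioo
      (fun t ht => (hPderiv t ht).differentiableAt.differentiableWithinAt)
      (fun t ht => by rw [Pi.zero_apply]; exact (hPderiv t ht).deriv) hs₁ hs₂
  have hmid : t₀ / 2 ∈ Ioo 0 t₀ := ⟨by linarith, by linarith⟩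
  have hcl : Icc 0 t₀ ⊆ closure (Ioo 0 t₀) := by
    rw [closure_Ioo ht₀.ne]
  have hEq : EqOn P (fun _ => P (t₀ / 2)) (Icc 0 t₀) :=
    Set.EqOn.of_subset_closure (fun t ht => hconst t ht _ hmid) hPcont continuousOn_const
      Ioo_subset_Icc_self hcl
  have h0 : P 0 = P (t₀ / 2) := hEq ⟨le_rfl, ht₀.le⟩
  have h1 : P t₀ = P (t₀ / 2) := hEq ⟨ht₀.le, le_rfl⟩
  show P t₀ = P 0
  rw [h1, h0]

/-- **The duality identity with its endpoints evaluated**: if moreover the datum `u(0)` vanishes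
for `‖x‖ > R` and `2r ≤ ‖x₁‖ - R - c₀t₀`, then
`∫ (A₀u(t₀, x))_ℂ · ψ(x) dx = 0` (`w(t₀) = ψ`, and at time `0` the supports of `u(0)` and `w(0)`
are disjoint). [cite: Rauch1986, Proof of Theorem p. 483] -/
theorem integral_mulVec_dotProduct_eq_zero (hu : (ofConstant A₀ A 0).IsClassicalSolution T u)
    (hdet : A₀.det ≠ 0) {C c₀ : ℝ} (hC : 0 ≤ C) (hc₀ : 0 ≤ c₀)
    (hT : ∀ τ : ℝ, HasExpType (adjPencil A₀ A τ) C (2 * Real.pi * c₀ * |τ|))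
    {R : ℝ} (h0 : ∀ x : Space d, R < ‖x‖ → u 0 x = 0) {t₀ : ℝ} (ht₀ : 0 < t₀) (ht₀T : t₀ ≤ T)
    {x₁ : Space d} {r : ℝ} (hr : 0 < r) (hx₁ : 2 * r ≤ ‖x₁‖ - R - c₀ * t₀)
    {ψ : Space d → Fin k → ℂ} (hψ : ContDiff ℝ ∞ ψ) (hc : HasCompactSupport ψ)
    (hsupp : tsupport ψ ⊆ closedBall x₁ r) :
    ∫ x, (A₀.map (algebraMap ℝ ℂ) *ᵥ cplx (u t₀) x) ⬝ᵥ ψ x = 0 := by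
  have h := integral_pairF_eq hu hdet hC hc₀ hT hψ hc hr.le hsupp ht₀ ht₀T
  have hL : (fun x => pairF A₀ A u t₀ ψ t₀ x) =
      fun x => (A₀.map (algebraMap ℝ ℂ) *ᵥ cplx (u t₀) x) ⬝ᵥ ψ x := by
    funext x; rw [pairF, adjSol_self hψ hc]
  have hR : (fun x => pairF A₀ A u t₀ ψ 0 x) = fun _ => 0 := by
    funext x
    rw [pairF]
    rcases lt_or_ge R ‖x‖ with hx | hx
    · rw [cplx_apply, h0 x hx, map_zero, mulVec_zero, zero_dotProduct]
    · have hfar : r + c₀ * |0 - t₀| < ‖x - x₁‖ := by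
        rw [zero_sub, abs_neg, abs_of_pos ht₀]
        have h1 : ‖x₁‖ - ‖x‖ ≤ ‖x - x₁‖ := by
          rw [← norm_neg (x - x₁), neg_sub]; exact norm_sub_norm_le x₁ x
        linarith
      rw [adjSol_eq_zero hC hc₀ hT hψ hc hr.le hsupp t₀ 0 hfar, dotProduct_zero]
  rw [hL, hR, integral_zero] at h
  exact h

/-- **Localisation by bumps**: a continuous real function whose integrals against all small
bumps centred at `x₁` vanish is `0` at `x₁`. [folklore] -/
theorem eq_zero_of_integral_mul_bump_eq_zero {g : Space d → ℝ} (hg : Continuous g) (x₁ : Space d)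
    {r : ℝ} (hr : 0 < r) (h : ∀ φ : ContDiffBump x₁, φ.rOut ≤ r → ∫ x, g x * φ x = 0) :
    g x₁ = 0 := by
  by_contra hne
  wlog hpos : 0 < g x₁ generalizing g with H
  · refine H (g := fun x => -g x) hg.neg (fun φ hφ => ?_) (by simpa using hne)
      (by simp only [not_lt] at hpos; exact neg_pos.2 (lt_of_le_of_ne hpos hne))
    have := h φ hφ
    simp only [neg_mul, integral_neg, this, neg_zero]
  -- `g > g(x₁)/2` near `x₁`
  obtain ⟨δ, hδ, hnear⟩ := Metric.continuousAt_iff.1 hg.continuousAt (g x₁ / 2) (by linarith)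
  set ρ' : ℝ := min δ r / 2 with hρ'
  have hρ'0 : 0 < ρ' := by rw [hρ']; positivity
  let φ : ContDiffBump x₁ := ⟨ρ' / 2, ρ', by positivity, by linarith⟩
  have hφr : φ.rOut ≤ r := by
    show ρ' ≤ r
    rw [hρ']; linarith [min_le_right δ r]
  have hφδ : φ.rOut < δ := by
    show ρ' < δ
    rw [hρ']; linarith [min_le_left δ r]
  -- `(g x₁ / 2) φ ≤ g φ` pointwise
  have hle : ∀ x, g x₁ / 2 * φ x ≤ g x * φ x := by
    intro x
    by_cases hx : x ∈ ball x₁ φ.rOut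
    · have hgx : g x₁ / 2 < g x := by
        have := hnear (mem_ball.1 (ball_subset_ball hφδ.le hx))
        rw [Real.dist_eq] at this
        linarith [abs_sub_lt_iff.1 this]
      exact mul_le_mul_of_nonneg_right hgx.le φ.nonneg
    · have : φ x = 0 := by
        have hx' : x ∉ Function.support (φ : Space d → ℝ) := by rwa [φ.support_eq]
        simpa [Function.mem_support] using hx'
      rw [this, mul_zero, mul_zero]
  have hint : Integrable (fun x => g x * φ x) :=
    (hg.mul φ.continuous).integrable_of_hasCompactSupport φ.hasCompactSupport.mul_left
  have hint' : Integrable (fun x => g x₁ / 2 * φ x) := φ.integrable.const_mul _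
  have h1 : ∫ x, g x₁ / 2 * φ x ≤ ∫ x, g x * φ x := integral_mono hint' hint hle
  have h2 : 0 < ∫ x, g x₁ / 2 * φ x := by
    rw [integral_const_mul]
    exact mul_pos (by linarith) φ.integral_pos
  linarith [h φ hφr]

/-- Entries of `x ↦ A₀ u(t, x)` are continuous for a continuous slice. [folklore] -/
theorem continuous_mulVec_apply {f : Space d → Fin k → ℝ} (hf : Continuous f)
    (M : Matrix (Fin k) (Fin k) ℝ) (i : Fin k) : Continuous fun x => (M *ᵥ f x) i := by
  have h : (fun x => (M *ᵥ f x) i) = fun x => ∑ j, M i j * f x j := by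
    funext x; rfl
  rw [h]
  exact continuous_finsetSum _ fun j _ => continuous_const.mul ((continuous_apply j).comp hf)

/-- **Finite speed of propagation for constant-coefficient systems in Rauch's class at `0`**
(both branches: symmetrizable, or `A₀` invertible and strictly hyperbolic): there is `c ≥ 0`
such that every classical solution `u` of `A₀∂ₜu + Σ Aⱼ∂ⱼu = 0` on `[0, T] × ℝᵈ` with
`u(0, x) = 0` for `‖x‖ > R` satisfies `u(t, x) = 0` for `‖x‖ > R + ct`, `0 ≤ t ≤ T`.
Proof (Holmgren–John duality with explicit adjoint solutions): pair `u` with the adjoint solution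
`w(t) = e^{-(t-t₀)G*}(D)ψ` (`adjSol`), which by the Paley–Wiener deformation theorem
(`Literature.Analysis.Fourier.multiplierOp_exp_apply_eq_zero_of_dist`) and the complexified
symbol bound (`exists_hasExpType_adjPencil`, Brenner's (0.3) with the shift `ibν` as zeroth-order
term) is supported in `B̄(x₁, r + c|t - t₀|)`; `∫ (A₀u)·w dx` is constant in `t`
(`integral_pairF_eq`), equals `∫ (A₀u(t₀))·ψ` at `t₀` and `0` at `t = 0` when the supports are
disjoint, so `A₀u(t₀, x₁) = 0` by localisation with bumps. This is the constant-coefficient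
case of "the finite speed of propagation for (1)" [Rauch1986, p. 482], cf.
`Rauch1986_finitePropagationSpeed` (whose strictly hyperbolic branch for general quasilinear
systems is open in the tree). [cite: Rauch1986, Proof of Theorem p. 482; Brenner1973, (0.3) p. 75] -/
theorem hasPropagationSpeed_ofConstant (hS : (ofConstant A₀ A 0).IsRauchClass 0) :
    ∃ c : ℝ, 0 ≤ c ∧ (ofConstant A₀ A 0).HasPropagationSpeed 0 c := by
  obtain ⟨hdet, -⟩ := exists_continuous_symmetrizer_family hS
  obtain ⟨c₀, C, hc₀, hC, hT⟩ := exists_hasExpType_adjPencil hS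
  refine ⟨c₀, hc₀, fun T R u hu h0 t ht x hx => ?_⟩
  have h0' : ∀ y : Space d, R < ‖y‖ → u 0 y = 0 := fun y hy => h0 y hy
  rcases ht.1.eq_or_lt with h | htpos
  · subst h
    exact h0' x (by simpa using hx)
  · -- the radius of the test functions
    set r : ℝ := (‖x‖ - R - c₀ * t) / 2 with hr
    have hr0 : 0 < r := by rw [hr]; linarith
    have hx₁ : 2 * r ≤ ‖x‖ - R - c₀ * t := by rw [hr]; linarith
    -- every entry of `A₀ u(t, x)` vanishes
    have hAu : A₀ *ᵥ u t x = 0 := by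
      funext i
      have hcont : Continuous fun y => (A₀ *ᵥ u t y) i :=
        continuous_mulVec_apply (hu.contDiff_slice ht).continuous A₀ i
      refine eq_zero_of_integral_mul_bump_eq_zero hcont x hr0 fun φ hφ => ?_
      -- the test function `φ eᵢ`
      set ψ : Space d → Fin k → ℂ := fun y => ((φ y : ℝ) : ℂ) • (Pi.single i (1 : ℂ)) with hψ
      have hψd : ContDiff ℝ ∞ ψ :=
        (Complex.ofRealCLM.contDiff.comp φ.contDiff).smul contDiff_const
      have hφc : HasCompactSupport fun y => ((φ y : ℝ) : ℂ) :=
        φ.hasCompactSupport.comp_left Complex.ofReal_zero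
      have hψc : HasCompactSupport ψ := hφc.smul_right
      have hψs : tsupport ψ ⊆ closedBall x r := by
        refine (tsupport_smul_subset_left _ _).trans ?_
        refine (closure_mono (Function.support_comp_subset Complex.ofReal_zero _)).trans ?_
        rw [← tsupport, φ.tsupport_eq]
        exact closedBall_subset_closedBall hφ
      have key := integral_mulVec_dotProduct_eq_zero hu hdet hC hc₀ hT h0' htpos ht.2 hr0 hx₁
        hψd hψc hψs
      -- evaluate the pairing: `(A₀u)_ℂ · (φ eᵢ) = φ (A₀u)ᵢ`
      have hev : (fun y => (A₀.map (algebraMap ℝ ℂ) *ᵥ cplx (u t) y) ⬝ᵥ ψ y) =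
          fun y => (((A₀ *ᵥ u t y) i * φ y : ℝ) : ℂ) := by
        funext y
        rw [cplx_apply, ← ofRealPi_mulVec, hψ]
        simp only [dotProduct_smul, dotProduct_single, mul_one, ofRealPi_apply, smul_eq_mul]
        push_cast
        ring
      rw [hev, integral_complex_ofReal, Complex.ofReal_eq_zero] at key
      exact key
    have hinj : Function.Injective A₀.mulVec :=
      mulVec_injective_iff_isUnit.2 ((isUnit_iff_isUnit_det _).2 (isUnit_iff_ne_zero.2 hdet))
    exact hinj (by rw [hAu, mulVec_zero])

end Duality

/-! ### The discharge of `Rauch1986_L1GradientEstimate_imp_LpMultiplier` -/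

/-- **Rauch's reduction, discharged**: `Rauch1986_L1GradientEstimate_imp_LpMultiplier` holds.
The proof is the assembly `Rauch1986_L1GradientEstimate_imp_LpMultiplier_of` of
`NoBVEstimatesMultiDLinearStepAssembly.lean` with its three inputs now theorems: the
interpolation of the homogeneous Sobolev spaces
(`Literature.Analysis.Fourier.gradientLpBound_interpolation_holds`), Rauch's (6) with the Riesz
transforms (`Literature.Analysis.Fourier.isLpMultiplier_of_gradientLpBound_holds`), and — in
place of the general finite propagation speed fact, which the assembly only ever applied to the
constant-coefficient system — `hasPropagationSpeed_ofConstant`.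
[cite: Rauch1986, Proof of Theorem p. 483, (5)–(6)] -/
theorem Rauch1986_L1GradientEstimate_imp_LpMultiplier_holds :
    Rauch1986_L1GradientEstimate_imp_LpMultiplier := by
  intro d k A₀ A hS c T hc hT hyp p hp₁ hp₂
  obtain ⟨hdet, -⟩ := exists_continuous_symmetrizer_family hS
  obtain ⟨cₚ, hcₚ, hps⟩ := hasPropagationSpeed_ofConstant hS
  obtain ⟨C₀, hC₀⟩ := exists_nnreal_bound_rauchSymbol hS T
  have hM := measurable_rauchSymbol_apply A₀ A 0 T
  have hbdd : ∃ C : ℝ, ∀ (ξ : Space d) (a b : Fin k), ‖rauchSymbol A₀ A 0 T ξ a b‖ ≤ C :=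
    ⟨C₀, hC₀⟩
  rcases eq_or_lt_of_le hp₂ with rfl | hp₂'
  · exact isLpMultiplier_two_rauchSymbol hS T
  have h1 := hasGradientLpBoundWith_one_rauchSymbol hS hdet hcₚ hps hT.le hc.le hyp
  have h2 := hasGradientLpBoundWith_two_of_bounded hM hC₀
  obtain ⟨cp, hcp⟩ :=
    gradientLpBound_interpolation_holds (rauchSymbol A₀ A 0 T) hM hbdd h1 h2 p hp₁ hp₂'
  exact isLpMultiplier_of_gradientLpBound_holds (rauchSymbol A₀ A 0 T) hM hbdd p cp hp₁
    (hp₂'.trans ENNReal.ofNat_lt_top) hcp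

end Literature.Barriers.AtomisticToContinuum

end
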